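/-
Copyright: cell gate-hubbard-kl, typer seat t6 (D-0069 (2) B1 statement-typer wave). Statement-level skeleton of a
published text plus proofs; nothing here is a claim about the Hubbard model or about superconductivity.
-/
import Mathlib
import Literature.MathematicalPhysics.QuantumLattice.FermiRG.DR2000PartI
import HarnessLib

/-!
# Disertori–Rivasseau 2000, Part I — §III.2.1 (labellings of clustering tree structures) and §IV.4 Lemmas 9, 10

M. Disertori, V. Rivasseau, *Interacting Fermi liquid in two dimensions at finite temperature, Part I: Convergent
Attributions*, CMP **215** (2000) 251–290, arXiv:cond-mat/9907130 [DisertoriRivasseau2000]; render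
`paper:arxiv-cond-mat_9907130` (LOCATOR `pNNNN:Lm` = chunk:line of the corpus-TeX render).  Companion of
`FermiRG/DR2000PartI.lean` (rows DR1.L9 = F-049, DR1.L10 = F-050 of the cell's FACT-LIST; both optional, both PROVED here).

WHAT IS PRINTED.  §III.2.1 p0008:L1–31: «We want to relate a CTS at order n to an ordinary tree 𝒯 with n vertices. The n−1
lines of 𝒯 are labeled by an index l and the 2n−2 lines of the CTS are labeled by an index ℓ … A labeling 𝓛 of the CTS is a
one to one map between the set of vertices (crosses and dots) of the CTS and the vertices and lines of 𝒯, so that each cross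
of the CTS is labeled by a particular line of 𝒯, and each dot of the CTS by a particular vertex of 𝒯, satisfying a further
constraint. For each ℓ, let T_ℓ(𝓛) be the subset of 𝒯 made of all lines and vertices of 𝒯 corresponding to all crosses and
dots "above ℓ" (that is such that the unique path in CTS joining this cross or dot to the root passes through ℓ). The
constraint on the labeling 𝓛 is that T_ℓ(𝓛) has to be connected for all ℓ. We call N_ℓ(𝒯,𝓛) the number of external lines
of T hooked to T_ℓ(𝓛). … We consider only in what follows trees 𝒯 with coordination N_v at each vertex v bounded by 4 …
Remark that a tree can be considered as the list V = {N_v} of its coordination numbers plus the set of Wick contractions W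
which associates together two by two the half lines or "fields" hooked to each vertex, subject to the constraint that the
resulting graph is a tree.»  §IV.4 p0015:L205–214: «For each cross x of the CTS different from the root, there is one line
ℓ⁰ₓ going down (towards the root), and two lines ℓ¹ₓ and ℓ²ₓ going up. **Lemma 9.** For any cross x different from the
root: N_{ℓ⁰ₓ}(𝒯,𝓛) = N_{ℓ¹ₓ}(𝒯,𝓛) + N_{ℓ²ₓ}(𝒯,𝓛) − 2» (proof p0016:L1–6).  p0016:L8–16: «The following Lemma is an
improved version of Lemmas B4-B5 in [CR] … **Lemma 10.** Let CTS be a fixed Clustering Tree Structure of order n. We have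
Σ_𝒯 Σ_𝓛 (1/n!) ∏_ℓ 1/N_ℓ(𝒯,𝓛) ≤ 4ⁿ» (proof p0016:L17–52: N_ℓ depends only on V and on the dot part 𝓛ₒ of 𝓛; the number of
(W, 𝓛ₓ) compatible with (V, 𝓛ₒ) is ∏_ℓ N_ℓ(V,𝓛ₒ); n! dot labellings, Σ_V 1 ≤ 4ⁿ).

WHAT IS TYPED, AND HOW.  * The CTS is a plane representative `PlaneCTS` (file `DR2000PartI.lean`); its vertices and lines
are addressed by root paths `List Bool` (`false`/`true` = first/second subtree above a cross): `dotAddrs`, `crossAddrs`,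
`lineAddrs` (a line is named by the vertex at its upper end, so lines = non-root addresses), «above ℓ» = `dotsAbove` /
`crossesAbove` (recursive; = the prefix order, `mem_dotsAbove_iff`).  * A tree 𝒯 = (V, W) is `FieldTree n`: coordination
numbers `N v ∈ [1,4]` on the labelled vertex set `Fin n`, the Wick contraction `partner` = a fixed-point-free involution of
the fields `(v,i)`, `i < N v`, pairing fields at distinct vertices, with `Σ N_v = 2(n−1)` (n − 1 lines) and the resulting
graph connected (every proper vertex cut is crossed by a line) — «connected with n−1 lines» is the tree property.  * A
labelling is `Labelling t T`: a bijection `dotMap` dots → vertices and the bijection crosses ↔ lines encoded junk-free by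
`lineMap : fields → crosses` (constant on lines, onto, fibres = lines); the constraint «T_ℓ(𝓛) connected» = its lines have
their end-vertices among its vertices (`closed`) and every proper cut of its vertex set is crossed by one of its lines (`conn`).
* `extLines L ℓ` = N_ℓ(𝒯,𝓛) = the number of lines of 𝒯 with exactly one end-vertex in T_ℓ(𝓛) (counted through that end).
* **Lemma 9** = `Lemma9ExternalLines` (stated in ℕ as N_{ℓ⁰}+2 = N_{ℓ¹}+N_{ℓ²}; proved for every cross, the root included),
**Lemma 10** = `Lemma10LabellingSum`: for every finite set F of pairs (𝒯,𝓛) (a `Finset` of the sigma type — the type is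
finite, so this is the printed bound on the full sum; the `Fintype` form is `lemma10_sum_univ`),
Σ_{(𝒯,𝓛)∈F} (1/n!) ∏_ℓ 1/N_ℓ ≤ 4ⁿ.  Both are PROVED (`Lemma9ExternalLines_holds`, `Lemma10LabellingSum_holds`) following
the printed double count: N_ℓ(𝒯,𝓛) = Σ_{v∈T_ℓ} N_v − 2·#{crosses above ℓ} (`Labelling.extLines_add`), the map
(𝒯,𝓛) ↦ (V, 𝓛ₒ, oriented line ends per cross) is injective (`code_injective`; hence the type of pairs is finite,
`finite_pairs`) and its fibres have at most ∏_ℓ N_ℓ(V,𝓛ₒ) points (`PlaneCTS.card_valid_le`), and there are at most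
n!·4ⁿ pairs (V,𝓛ₒ).

DIVERGENCES.  (i) Vertices of 𝒯 are the labelled set `Fin n` (positions x₁…xₙ of (III.16)); the n! in the lemma is the
number of dot labellings, as in the printed proof.  (ii) «tree» = connected with n−1 lines (equivalent to acyclic connected
for multigraphs; stated by cuts).  (iii) The fields of a vertex are abstract slots `Fin 4` of which the first `N v` are used,
as in the printed count «Σ_V 1 ≤ 4ⁿ» (the spin/particle structure of the physical half-lines is not part of Lemma 10).
-/

noncomputable section

open Finset
open scoped BigOperators

namespace Literature.MathematicalPhysics.QuantumLattice.FermiRG.DR2000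

namespace PlaneCTS

/-! ## §III.2.1 Addresses of the dots, crosses and lines of a clustering tree structure -/

/-- Prefixing an address with one more step from the root (`false` = first, `true` = second subtree). [folklore] -/
def consAddr (b : Bool) : List Bool ↪ List Bool := ⟨List.cons b, List.cons_injective⟩

/-- Auxiliary structural lemma (addresses, clusters, field slots). [folklore] -/
@[simp] private theorem consAddr_apply (b : Bool) (a : List Bool) : consAddr b a = b :: a := rfl

/-- Addresses (root paths) of the dots of a plane CTS. [cite: DisertoriRivasseau2000, §III.2 Definition p0007:L141–146] -/
def dotAddrs : PlaneCTS → Finset (List Bool)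
  | dot => {[]}
  | cross l r => (dotAddrs l).map (consAddr false) ∪ (dotAddrs r).map (consAddr true)

/-- Addresses of the crosses of a plane CTS (the root cross is `[]`). [cite: DisertoriRivasseau2000, §III.2 Definition p0007:L141–146] -/
def crossAddrs : PlaneCTS → Finset (List Bool)
  | dot => ∅
  | cross l r => insert [] ((crossAddrs l).map (consAddr false) ∪ (crossAddrs r).map (consAddr true))

/-- All vertices (dots and crosses) of the CTS. [cite: DisertoriRivasseau2000, §III.2 Definition p0007:L141–146] -/
def nodeAddrs (t : PlaneCTS) : Finset (List Bool) := dotAddrs t ∪ crossAddrs t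

/-- The `2n−2` lines `ℓ` of the CTS, each named by the vertex at its upper end: the non-root vertices.
[cite: DisertoriRivasseau2000, §III.2.1 p0008:L2–4] -/
def lineAddrs (t : PlaneCTS) : Finset (List Bool) := (nodeAddrs t).erase []

/-- The dots «above» an address `a` (root path through `a`), as a recursive Finset.
[cite: DisertoriRivasseau2000, §III.2.1 p0008:L10–15] -/
def dotsAbove : PlaneCTS → List Bool → Finset (List Bool)
  | t, [] => dotAddrs t
  | dot, _ :: _ => ∅
  | cross l _, false :: a => (dotsAbove l a).map (consAddr false)
  | cross _ r, true :: a => (dotsAbove r a).map (consAddr true)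

/-- The crosses «above» (or at) an address `a`. [cite: DisertoriRivasseau2000, §III.2.1 p0008:L10–15] -/
def crossesAbove : PlaneCTS → List Bool → Finset (List Bool)
  | t, [] => crossAddrs t
  | dot, _ :: _ => ∅
  | cross l _, false :: a => (crossesAbove l a).map (consAddr false)
  | cross _ r, true :: a => (crossesAbove r a).map (consAddr true)

section AddressLemmas

variable {l r t : PlaneCTS} {a c d : List Bool} {b : Bool}

/-- Auxiliary structural lemma (addresses, clusters, field slots). [folklore] -/
@[simp] private theorem dotAddrs_dot : dotAddrs dot = {[]} := rfl
/-- Auxiliary structural lemma (addresses, clusters, field slots). [folklore] -/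
@[simp] private theorem crossAddrs_dot : crossAddrs dot = ∅ := rfl
/-- Auxiliary structural lemma (addresses, clusters, field slots). [folklore] -/
private theorem dotAddrs_cross : dotAddrs (cross l r) = (dotAddrs l).map (consAddr false) ∪ (dotAddrs r).map (consAddr true) := rfl
/-- Auxiliary structural lemma (addresses, clusters, field slots). [folklore] -/
private theorem crossAddrs_cross :
    crossAddrs (cross l r) = insert [] ((crossAddrs l).map (consAddr false) ∪ (crossAddrs r).map (consAddr true)) := rfl
/-- Auxiliary structural lemma (addresses, clusters, field slots). [folklore] -/
@[simp] private theorem dotsAbove_nil : dotsAbove t [] = dotAddrs t := by cases t <;> rfl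
/-- Auxiliary structural lemma (addresses, clusters, field slots). [folklore] -/
@[simp] private theorem crossesAbove_nil : crossesAbove t [] = crossAddrs t := by cases t <;> rfl
/-- Auxiliary structural lemma (addresses, clusters, field slots). [folklore] -/
@[simp] private theorem dotsAbove_dot_cons : dotsAbove dot (b :: a) = ∅ := rfl
/-- Auxiliary structural lemma (addresses, clusters, field slots). [folklore] -/
@[simp] private theorem crossesAbove_dot_cons : crossesAbove dot (b :: a) = ∅ := rfl
/-- Auxiliary structural lemma (addresses, clusters, field slots). [folklore] -/
@[simp] private theorem dotsAbove_cross_false : dotsAbove (cross l r) (false :: a) = (dotsAbove l a).map (consAddr false) := rfl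
/-- Auxiliary structural lemma (addresses, clusters, field slots). [folklore] -/
@[simp] private theorem dotsAbove_cross_true : dotsAbove (cross l r) (true :: a) = (dotsAbove r a).map (consAddr true) := rfl
/-- Auxiliary structural lemma (addresses, clusters, field slots). [folklore] -/
@[simp] private theorem crossesAbove_cross_false :
    crossesAbove (cross l r) (false :: a) = (crossesAbove l a).map (consAddr false) := rfl
/-- Auxiliary structural lemma (addresses, clusters, field slots). [folklore] -/
@[simp] private theorem crossesAbove_cross_true :
    crossesAbove (cross l r) (true :: a) = (crossesAbove r a).map (consAddr true) := rfl

/-- Membership in a `consAddr`-image. [folklore] -/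
private theorem mem_map_consAddr {s : Finset (List Bool)} : a ∈ s.map (consAddr b) ↔ ∃ a' ∈ s, b :: a' = a := by
  simp [Finset.mem_map]

/-- Auxiliary structural lemma (addresses, clusters, field slots). [folklore] -/
@[simp] private theorem cons_mem_map_consAddr_iff {s : Finset (List Bool)} {b' : Bool} :
    b :: a ∈ s.map (consAddr b') ↔ b = b' ∧ a ∈ s := by
  constructor
  · intro h
    obtain ⟨a', ha', he⟩ := mem_map_consAddr.1 h
    simp only [List.cons.injEq] at he
    exact ⟨he.1.symm, he.2 ▸ ha'⟩
  · rintro ⟨rfl, ha⟩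
    exact mem_map_consAddr.2 ⟨a, ha, rfl⟩

/-- Auxiliary structural lemma (addresses, clusters, field slots). [folklore] -/
@[simp] private theorem nil_not_mem_map_consAddr {s : Finset (List Bool)} : [] ∉ s.map (consAddr b) := by
  simp [Finset.mem_map]

/-- Auxiliary structural lemma (addresses, clusters, field slots). [folklore] -/
@[simp] private theorem cons_mem_dotAddrs_cross : b :: a ∈ dotAddrs (cross l r) ↔ a ∈ dotAddrs (if b then r else l) := by
  cases b <;> simp [dotAddrs_cross]

/-- Auxiliary structural lemma (addresses, clusters, field slots). [folklore] -/
@[simp] private theorem cons_mem_crossAddrs_cross : b :: a ∈ crossAddrs (cross l r) ↔ a ∈ crossAddrs (if b then r else l) := by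
  cases b <;> simp [crossAddrs_cross]

/-- Auxiliary structural lemma (addresses, clusters, field slots). [folklore] -/
@[simp] private theorem nil_not_mem_dotAddrs_cross : [] ∉ dotAddrs (cross l r) := by simp [dotAddrs_cross]

/-- Auxiliary structural lemma (addresses, clusters, field slots). [folklore] -/
@[simp] private theorem nil_mem_crossAddrs_cross : [] ∈ crossAddrs (cross l r) := by simp [crossAddrs_cross]

/-- Auxiliary structural lemma (addresses, clusters, field slots). [folklore] -/
@[simp] private theorem cons_not_mem_dotAddrs_dot : b :: a ∉ dotAddrs dot := by simp

/-- The root is a vertex. [folklore] -/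
private theorem nil_mem_nodeAddrs : [] ∈ nodeAddrs t := by
  cases t with
  | dot => simp [nodeAddrs]
  | cross l r => simp [nodeAddrs]

/-- Dots and crosses have different addresses. [folklore] -/
private theorem disjoint_dotAddrs_crossAddrs : ∀ t : PlaneCTS, Disjoint (dotAddrs t) (crossAddrs t)
  | dot => by simp
  | cross l r => by
      have ihl := disjoint_dotAddrs_crossAddrs l
      have ihr := disjoint_dotAddrs_crossAddrs r
      rw [Finset.disjoint_left] at ihl ihr ⊢
      intro x hx hx'
      cases x with
      | nil => simp at hx
      | cons b x =>
        rw [cons_mem_dotAddrs_cross] at hx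
        rw [cons_mem_crossAddrs_cross] at hx'
        cases b
        · exact ihl (by simpa using hx) (by simpa using hx')
        · exact ihr (by simpa using hx) (by simpa using hx')

/-- The order is positive. [folklore] -/
private theorem dots_pos : ∀ t : PlaneCTS, 0 < t.dots
  | dot => Nat.one_pos
  | cross l _ => Nat.add_pos_left (dots_pos l) _

/-- Auxiliary structural lemma (addresses, clusters, field slots). [folklore] -/
private theorem not_mem_crossAddrs_of_mem_dotAddrs (h : d ∈ dotAddrs t) : d ∉ crossAddrs t :=
  Finset.disjoint_left.1 (disjoint_dotAddrs_crossAddrs t) h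

/-- Auxiliary structural lemma (addresses, clusters, field slots). [folklore] -/
private theorem not_mem_dotAddrs_of_mem_crossAddrs (h : c ∈ crossAddrs t) : c ∉ dotAddrs t :=
  fun h' => not_mem_crossAddrs_of_mem_dotAddrs h' h

/-- The number of dots is the order. [cite: DisertoriRivasseau2000, §III.2 Definition p0007:L141–146] -/
theorem card_dotAddrs : ∀ t : PlaneCTS, (dotAddrs t).card = t.dots
  | dot => rfl
  | cross l r => by
      rw [dotAddrs_cross, Finset.card_union_of_disjoint, Finset.card_map, Finset.card_map, card_dotAddrs l,
        card_dotAddrs r, dots]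
      rw [Finset.disjoint_left]
      intro x hx hx'
      obtain ⟨a, -, rfl⟩ := mem_map_consAddr.1 hx
      simp at hx'

/-- A CTS of order `n` has `n − 1` crosses. [cite: DisertoriRivasseau2000, §III.2 Definition p0007:L141–146] -/
theorem card_crossAddrs_add_one : ∀ t : PlaneCTS, (crossAddrs t).card + 1 = t.dots
  | dot => rfl
  | cross l r => by
      rw [crossAddrs_cross, Finset.card_insert_of_notMem, Finset.card_union_of_disjoint, Finset.card_map,
        Finset.card_map, dots, ← card_crossAddrs_add_one l, ← card_crossAddrs_add_one r]
      · ring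
      · rw [Finset.disjoint_left]
        intro x hx hx'
        obtain ⟨a, -, rfl⟩ := mem_map_consAddr.1 hx
        simp at hx'
      · simp

/-- The lines of a CTS with a cross root: those of the two subtrees, shifted, plus the two lines at the root.
[cite: DisertoriRivasseau2000, §III.2.1 p0008:L2–4] -/
theorem lineAddrs_cross :
    lineAddrs (cross l r) = (nodeAddrs l).map (consAddr false) ∪ (nodeAddrs r).map (consAddr true) := by
  ext x
  simp only [lineAddrs, nodeAddrs, Finset.mem_erase, Finset.mem_union, Finset.map_union]
  cases x with
  | nil => simp
  | cons b x => cases b <;> simp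

/-- Auxiliary structural lemma (addresses, clusters, field slots). [folklore] -/
private theorem nodeAddrs_eq_insert : nodeAddrs t = insert [] (lineAddrs t) := by
  rw [lineAddrs, Finset.insert_erase nil_mem_nodeAddrs]

/-- Auxiliary structural lemma (addresses, clusters, field slots). [folklore] -/
private theorem nil_not_mem_lineAddrs : [] ∉ lineAddrs t := by simp [lineAddrs]

/-- Auxiliary structural lemma (addresses, clusters, field slots). [folklore] -/
@[simp] private theorem lineAddrs_dot : lineAddrs dot = ∅ := by decide

/-- A product over the lines of `cross l r` splits into the two root lines and the shifted lines of `l` and `r`. [folklore] -/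
private theorem prod_lineAddrs_cross {M : Type*} [CommMonoid M] (f : List Bool → M) :
    ∏ a ∈ lineAddrs (cross l r), f a =
      (f [false] * ∏ a ∈ lineAddrs l, f (false :: a)) * (f [true] * ∏ a ∈ lineAddrs r, f (true :: a)) := by
  rw [lineAddrs_cross, Finset.prod_union, Finset.prod_map, Finset.prod_map, nodeAddrs_eq_insert (t := l),
    nodeAddrs_eq_insert (t := r), Finset.prod_insert nil_not_mem_lineAddrs, Finset.prod_insert nil_not_mem_lineAddrs]
  · rfl
  · rw [Finset.disjoint_left]
    intro x hx hx'
    obtain ⟨a, -, rfl⟩ := mem_map_consAddr.1 hx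
    simp at hx'

/-- The two children of a cross are vertices, hence lines. [cite: DisertoriRivasseau2000, §IV.4 p0015:L207–209] -/
theorem append_mem_nodeAddrs_of_mem_crossAddrs : ∀ {t : PlaneCTS} {c : List Bool} (b : Bool),
    c ∈ crossAddrs t → c ++ [b] ∈ nodeAddrs t
  | dot, c, b, h => by simp at h
  | cross l r, [], b, _ => by
      cases b
      · have := nil_mem_nodeAddrs (t := l)
        simp only [nodeAddrs, Finset.mem_union] at this ⊢
        simpa using this
      · have := nil_mem_nodeAddrs (t := r)
        simp only [nodeAddrs, Finset.mem_union] at this ⊢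
        simpa using this
  | cross l r, b' :: c, b, h => by
      rw [cons_mem_crossAddrs_cross] at h
      have ih := append_mem_nodeAddrs_of_mem_crossAddrs b h
      simp only [nodeAddrs, Finset.mem_union, List.cons_append] at ih ⊢
      cases b' <;> simpa using ih

/-- Auxiliary structural lemma (addresses, clusters, field slots). [folklore] -/
private theorem append_mem_lineAddrs_of_mem_crossAddrs (b : Bool) (h : c ∈ crossAddrs t) : c ++ [b] ∈ lineAddrs t := by
  rw [lineAddrs, Finset.mem_erase]
  exact ⟨by simp, append_mem_nodeAddrs_of_mem_crossAddrs b h⟩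

/-- Every line hangs below a vertex whose parent is a cross: `a = c ++ [b]`. [cite: DisertoriRivasseau2000, §IV.4 p0015:L207–209] -/
theorem exists_parent_of_mem_lineAddrs : ∀ {t : PlaneCTS} {a : List Bool},
    a ∈ lineAddrs t → ∃ c ∈ crossAddrs t, ∃ b : Bool, a = c ++ [b]
  | dot, a, h => by simp at h
  | cross l r, [], h => by simp [lineAddrs] at h
  | cross l r, b' :: a, h => by
      have hnode : a ∈ nodeAddrs (if b' then r else l) := by
        rw [lineAddrs, Finset.mem_erase, nodeAddrs, Finset.mem_union, cons_mem_dotAddrs_cross,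
          cons_mem_crossAddrs_cross] at h
        simpa [nodeAddrs] using h.2
      by_cases ha : a = []
      · subst ha
        exact ⟨[], nil_mem_crossAddrs_cross, b', by simp⟩
      · have hline : a ∈ lineAddrs (if b' then r else l) := by
          rw [lineAddrs, Finset.mem_erase]; exact ⟨ha, hnode⟩
        obtain ⟨c, hc, b, rfl⟩ := exists_parent_of_mem_lineAddrs hline
        refine ⟨b' :: c, ?_, b, by simp⟩
        rw [cons_mem_crossAddrs_cross]; exact hc

/-- The dots above a cross are those above its two children, disjointly. [cite: DisertoriRivasseau2000, §III.2.1 p0008:L10–15] -/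
theorem dotsAbove_cross_eq : ∀ {t : PlaneCTS} {c : List Bool}, c ∈ crossAddrs t →
    dotsAbove t c = dotsAbove t (c ++ [false]) ∪ dotsAbove t (c ++ [true])
  | dot, c, h => by simp at h
  | cross l r, [], _ => by simp [dotAddrs_cross]
  | cross l r, b :: c, h => by
      rw [cons_mem_crossAddrs_cross] at h
      cases b
      · simp only [List.cons_append, dotsAbove_cross_false, Bool.false_eq_true, ↓reduceIte] at h ⊢
        rw [dotsAbove_cross_eq h, Finset.map_union]
      · simp only [List.cons_append, dotsAbove_cross_true, ↓reduceIte] at h ⊢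
        rw [dotsAbove_cross_eq h, Finset.map_union]

/-- Auxiliary structural lemma (addresses, clusters, field slots). [folklore] -/
private theorem disjoint_dotsAbove_children : ∀ {t : PlaneCTS} {c : List Bool}, c ∈ crossAddrs t →
    Disjoint (dotsAbove t (c ++ [false])) (dotsAbove t (c ++ [true]))
  | dot, c, h => by simp at h
  | cross l r, [], _ => by
      simp only [List.nil_append, dotsAbove_cross_false, dotsAbove_nil, dotsAbove_cross_true]
      rw [Finset.disjoint_left]
      intro x hx hx'
      obtain ⟨a, -, rfl⟩ := mem_map_consAddr.1 hx
      simp at hx'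
  | cross l r, b :: c, h => by
      rw [cons_mem_crossAddrs_cross] at h
      cases b
      · simp only [List.cons_append, dotsAbove_cross_false, Bool.false_eq_true, ↓reduceIte] at h ⊢
        exact (Finset.disjoint_map _).2 (disjoint_dotsAbove_children h)
      · simp only [List.cons_append, dotsAbove_cross_true, ↓reduceIte] at h ⊢
        exact (Finset.disjoint_map _).2 (disjoint_dotsAbove_children h)

/-- The crosses above (or at) a cross: itself and those above its two children. [cite: DisertoriRivasseau2000, §III.2.1 p0008:L10–15] -/
theorem crossesAbove_cross_eq : ∀ {t : PlaneCTS} {c : List Bool}, c ∈ crossAddrs t →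
    crossesAbove t c = insert c (crossesAbove t (c ++ [false]) ∪ crossesAbove t (c ++ [true]))
  | dot, c, h => by simp at h
  | cross l r, [], _ => by simp [crossAddrs_cross]
  | cross l r, b :: c, h => by
      rw [cons_mem_crossAddrs_cross] at h
      cases b
      · simp only [List.cons_append, crossesAbove_cross_false, Bool.false_eq_true, ↓reduceIte] at h ⊢
        rw [crossesAbove_cross_eq h, Finset.map_insert, Finset.map_union]
        rfl
      · simp only [List.cons_append, crossesAbove_cross_true, ↓reduceIte] at h ⊢
        rw [crossesAbove_cross_eq h, Finset.map_insert, Finset.map_union]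
        rfl

/-- Auxiliary structural lemma (addresses, clusters, field slots). [folklore] -/
private theorem disjoint_crossesAbove_children : ∀ {t : PlaneCTS} {c : List Bool}, c ∈ crossAddrs t →
    Disjoint (crossesAbove t (c ++ [false])) (crossesAbove t (c ++ [true]))
  | dot, c, h => by simp at h
  | cross l r, [], _ => by
      simp only [List.nil_append, crossesAbove_cross_false, crossesAbove_nil, crossesAbove_cross_true]
      rw [Finset.disjoint_left]
      intro x hx hx'
      obtain ⟨a, -, rfl⟩ := mem_map_consAddr.1 hx
      simp at hx'
  | cross l r, b :: c, h => by
      rw [cons_mem_crossAddrs_cross] at h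
      cases b
      · simp only [List.cons_append, crossesAbove_cross_false, Bool.false_eq_true, ↓reduceIte] at h ⊢
        exact (Finset.disjoint_map _).2 (disjoint_crossesAbove_children h)
      · simp only [List.cons_append, crossesAbove_cross_true, ↓reduceIte] at h ⊢
        exact (Finset.disjoint_map _).2 (disjoint_crossesAbove_children h)

/-- Auxiliary structural lemma (addresses, clusters, field slots). [folklore] -/
private theorem not_mem_crossesAbove_children : ∀ {t : PlaneCTS} {c : List Bool} (b : Bool), c ∈ crossAddrs t →
    c ∉ crossesAbove t (c ++ [b])
  | dot, c, b, h => by simp at h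
  | cross l r, [], b, _ => by cases b <;> simp
  | cross l r, b' :: c, b, h => by
      rw [cons_mem_crossAddrs_cross] at h
      cases b'
      · simp only [List.cons_append, crossesAbove_cross_false, Bool.false_eq_true, ↓reduceIte,
          cons_mem_map_consAddr_iff, true_and] at h ⊢
        exact not_mem_crossesAbove_children b h
      · simp only [List.cons_append, crossesAbove_cross_true, ↓reduceIte, cons_mem_map_consAddr_iff, true_and] at h ⊢
        exact not_mem_crossesAbove_children b h

/-- Counting the crosses above a cross. [folklore] -/
private theorem card_crossesAbove_cross (h : c ∈ crossAddrs t) :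
    (crossesAbove t c).card = (crossesAbove t (c ++ [false])).card + (crossesAbove t (c ++ [true])).card + 1 := by
  rw [crossesAbove_cross_eq h, Finset.card_insert_of_notMem,
    Finset.card_union_of_disjoint (disjoint_crossesAbove_children h)]
  rw [Finset.mem_union, not_or]
  exact ⟨not_mem_crossesAbove_children false h, not_mem_crossesAbove_children true h⟩

/-- Above a dot there is exactly that dot and no cross. [cite: DisertoriRivasseau2000, §III.2.1 p0008:L10–15] -/
theorem dotsAbove_of_mem_dotAddrs : ∀ {t : PlaneCTS} {d : List Bool}, d ∈ dotAddrs t → dotsAbove t d = {d}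
  | dot, [], _ => rfl
  | dot, b :: d, h => by simp at h
  | cross l r, [], h => by simp at h
  | cross l r, b :: d, h => by
      rw [cons_mem_dotAddrs_cross] at h
      cases b
      · simp only [dotsAbove_cross_false, Bool.false_eq_true, ↓reduceIte] at h ⊢
        rw [dotsAbove_of_mem_dotAddrs h]; rfl
      · simp only [dotsAbove_cross_true, ↓reduceIte] at h ⊢
        rw [dotsAbove_of_mem_dotAddrs h]; rfl

/-- Auxiliary structural lemma (addresses, clusters, field slots). [folklore] -/
private theorem crossesAbove_of_mem_dotAddrs : ∀ {t : PlaneCTS} {d : List Bool}, d ∈ dotAddrs t → crossesAbove t d = ∅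
  | dot, [], _ => rfl
  | dot, b :: d, h => by simp at h
  | cross l r, [], h => by simp at h
  | cross l r, b :: d, h => by
      rw [cons_mem_dotAddrs_cross] at h
      cases b
      · simp only [crossesAbove_cross_false, Bool.false_eq_true, ↓reduceIte] at h ⊢
        rw [crossesAbove_of_mem_dotAddrs h]; rfl
      · simp only [crossesAbove_cross_true, ↓reduceIte] at h ⊢
        rw [crossesAbove_of_mem_dotAddrs h]; rfl

/-- Auxiliary structural lemma (addresses, clusters, field slots). [folklore] -/
private theorem dotsAbove_subset : ∀ (t : PlaneCTS) (a : List Bool), dotsAbove t a ⊆ dotAddrs t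
  | t, [] => by simp
  | dot, _ :: _ => by simp
  | cross l r, false :: a => by
      intro x hx
      simp only [dotsAbove_cross_false] at hx
      obtain ⟨a', ha', rfl⟩ := mem_map_consAddr.1 hx
      simpa using dotsAbove_subset l a ha'
  | cross l r, true :: a => by
      intro x hx
      simp only [dotsAbove_cross_true] at hx
      obtain ⟨a', ha', rfl⟩ := mem_map_consAddr.1 hx
      simpa using dotsAbove_subset r a ha'

/-- Auxiliary structural lemma (addresses, clusters, field slots). [folklore] -/
private theorem crossesAbove_subset : ∀ (t : PlaneCTS) (a : List Bool), crossesAbove t a ⊆ crossAddrs t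
  | t, [] => by simp
  | dot, _ :: _ => by simp
  | cross l r, false :: a => by
      intro x hx
      simp only [crossesAbove_cross_false] at hx
      obtain ⟨a', ha', rfl⟩ := mem_map_consAddr.1 hx
      simpa using crossesAbove_subset l a ha'
  | cross l r, true :: a => by
      intro x hx
      simp only [crossesAbove_cross_true] at hx
      obtain ⟨a', ha', rfl⟩ := mem_map_consAddr.1 hx
      simpa using crossesAbove_subset r a ha'

/-- A cross is above itself. [folklore] -/
private theorem self_mem_crossesAbove (h : c ∈ crossAddrs t) : c ∈ crossesAbove t c := by
  rw [crossesAbove_cross_eq h]; exact Finset.mem_insert_self _ _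

/-- Every vertex has a dot above it. [folklore] -/
private theorem dotsAbove_nonempty : ∀ {t : PlaneCTS} {a : List Bool}, a ∈ nodeAddrs t → (dotsAbove t a).Nonempty
  | t, [], _ => by
      rw [dotsAbove_nil, ← Finset.card_pos, card_dotAddrs]
      exact dots_pos t
  | dot, b :: a, h => by simp [nodeAddrs] at h
  | cross l r, b :: a, h => by
      have h' : a ∈ nodeAddrs (if b then r else l) := by
        simp only [nodeAddrs, Finset.mem_union, cons_mem_dotAddrs_cross, cons_mem_crossAddrs_cross] at h
        simpa [nodeAddrs] using h
      cases b
      · simp only [Bool.false_eq_true, ↓reduceIte] at h'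
        simpa using dotsAbove_nonempty h'
      · simp only [↓reduceIte] at h'
        simpa using dotsAbove_nonempty h'

/-- «Above» is the prefix order on root paths (faithfulness of the recursive `dotsAbove`).
[cite: DisertoriRivasseau2000, §III.2.1 p0008:L10–15] -/
theorem mem_dotsAbove_iff : ∀ (t : PlaneCTS) (a d : List Bool), d ∈ dotsAbove t a ↔ d ∈ dotAddrs t ∧ a <+: d
  | t, [], d => by simp
  | dot, b :: a, d => by
      cases d <;> simp
  | cross l r, false :: a, d => by
      cases d with
      | nil => simp
      | cons b' d =>
        rw [dotsAbove_cross_false, cons_mem_map_consAddr_iff, cons_mem_dotAddrs_cross, List.cons_prefix_cons,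
          mem_dotsAbove_iff l a d]
        constructor
        · rintro ⟨rfl, h1, h2⟩; exact ⟨by simpa using h1, rfl, h2⟩
        · rintro ⟨h1, h2, h3⟩; subst h2; exact ⟨rfl, by simpa using h1, h3⟩
  | cross l r, true :: a, d => by
      cases d with
      | nil => simp
      | cons b' d =>
        rw [dotsAbove_cross_true, cons_mem_map_consAddr_iff, cons_mem_dotAddrs_cross, List.cons_prefix_cons,
          mem_dotsAbove_iff r a d]
        constructor
        · rintro ⟨rfl, h1, h2⟩; exact ⟨by simpa using h1, rfl, h2⟩
        · rintro ⟨h1, h2, h3⟩; subst h2; exact ⟨rfl, by simpa using h1, h3⟩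

/-- «Above» for crosses is the prefix order on root paths (faithfulness of the recursive `crossesAbove`).
[cite: DisertoriRivasseau2000, §III.2.1 p0008:L10–15] -/
theorem mem_crossesAbove_iff : ∀ (t : PlaneCTS) (a c : List Bool), c ∈ crossesAbove t a ↔ c ∈ crossAddrs t ∧ a <+: c
  | t, [], c => by simp
  | dot, b :: a, c => by
      cases c <;> simp
  | cross l r, false :: a, c => by
      cases c with
      | nil => simp
      | cons b' c =>
        rw [crossesAbove_cross_false, cons_mem_map_consAddr_iff, cons_mem_crossAddrs_cross, List.cons_prefix_cons,
          mem_crossesAbove_iff l a c]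
        constructor
        · rintro ⟨rfl, h1, h2⟩; exact ⟨by simpa using h1, rfl, h2⟩
        · rintro ⟨h1, h2, h3⟩; subst h2; exact ⟨rfl, by simpa using h1, h3⟩
  | cross l r, true :: a, c => by
      cases c with
      | nil => simp
      | cons b' c =>
        rw [crossesAbove_cross_true, cons_mem_map_consAddr_iff, cons_mem_crossAddrs_cross, List.cons_prefix_cons,
          mem_crossesAbove_iff r a c]
        constructor
        · rintro ⟨rfl, h1, h2⟩; exact ⟨by simpa using h1, rfl, h2⟩
        · rintro ⟨h1, h2, h3⟩; subst h2; exact ⟨rfl, by simpa using h1, h3⟩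

/-- The vertex set of `T_ℓ(𝓛)`: the images, under a dot labelling `δ`, of the dots above `a`.
[cite: DisertoriRivasseau2000, §III.2.1 p0008:L10–17] -/
def vertsAbove {n : ℕ} (t : PlaneCTS) (δ : ↥(dotAddrs t) → Fin n) (a : List Bool) : Finset (Fin n) :=
  (Finset.univ.filter (fun d : ↥(dotAddrs t) => (d : List Bool) ∈ dotsAbove t a)).image δ

end AddressLemmas

end PlaneCTS

open PlaneCTS

/-! ## §III.2.1 Trees `𝒯 = (V, W)`: coordination numbers and Wick contractions -/

/-- Raw field slots: a vertex of `𝒯` and a slot index (at most four fields per vertex).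
[cite: DisertoriRivasseau2000, §III.2.1 p0008:L25–31] -/
abbrev RawField (n : ℕ) : Type := Fin n × Fin 4

/-- **A tree `𝒯` on the `n` labelled vertices, «considered as the list `V = {N_v}` of its coordination numbers plus the set
of Wick contractions `W` which associates together two by two the half lines or "fields" hooked to each vertex, subject to
the constraint that the resulting graph is a tree»** (p0008:L25–31), with «coordination `N_v` at each vertex `v` bounded by
4» (L25–27) and `N_v ≥ 1` («`N_v` is an integer between 1 and 4», p0016:L49–50).  The fields of `v` are the slots `(v, i)`,
`i < N v`; `W` is the fixed-point-free involution `partner` pairing fields at distinct vertices (a line = a pair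
`{f, partner f}`); «the resulting graph is a tree» = `n − 1` lines (`Σ_v N_v = 2(n−1)`) and connected (every cut of the
vertex set into two non-empty parts is crossed by a line).
[cite: DisertoriRivasseau2000, §III.2.1 p0008:L25–31] -/
structure FieldTree (n : ℕ) where
  /-- the coordination numbers `N_v` -/
  N : Fin n → ℕ
  /-- `1 ≤ N_v` -/
  one_le_N : ∀ v, 1 ≤ N v
  /-- `N_v ≤ 4` -/
  N_le_four : ∀ v, N v ≤ 4
  /-- the Wick contraction `W`: each field is paired with its partner -/
  partner : {f : RawField n // ((f.2 : Fin 4) : ℕ) < N f.1} → {f : RawField n // ((f.2 : Fin 4) : ℕ) < N f.1}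
  /-- `W` pairs the fields two by two -/
  partner_partner : ∀ f, partner (partner f) = f
  /-- a line joins two distinct vertices -/
  partner_vert_ne : ∀ f, (partner f).1.1 ≠ f.1.1
  /-- `n − 1` lines -/
  sum_N : ∑ v, N v + 2 = 2 * n
  /-- the graph is connected: every proper cut is crossed by a line -/
  connected : ∀ S : Finset (Fin n), S.Nonempty → Sᶜ.Nonempty → ∃ f, f.1.1 ∈ S ∧ (partner f).1.1 ∉ S

namespace FieldTree

/-- The fields (half-lines) of `𝒯`: slots `(v, i)` with `i < N_v`. [cite: DisertoriRivasseau2000, §III.2.1 p0008:L28–30] -/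
abbrev Field {n : ℕ} (T : FieldTree n) : Type := {f : RawField n // ((f.2 : Fin 4) : ℕ) < T.N f.1}

end FieldTree

/-! ## §III.2.1 Labellings `𝓛` of a CTS onto a tree, and `N_ℓ(𝒯,𝓛)` -/

/-- **A labelling `𝓛` of the CTS `t` onto the tree `𝒯`** (p0008:L4–17): «a one to one map between the set of vertices
(crosses and dots) of the CTS and the vertices and lines of `𝒯`, so that each cross of the CTS is labeled by a particular
line of `𝒯`, and each dot of the CTS by a particular vertex of `𝒯`» — `dotMap` (a bijection dots → vertices) and the
bijection crosses ↔ lines, recorded through its inverse composed with field ↦ line: `lineMap f` = the cross labelling the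
line of the field `f` (constant on lines, onto, with fibres exactly the lines) — «satisfying a further constraint … `T_ℓ(𝓛)`
[the lines and vertices of `𝒯` corresponding to the crosses and dots above `ℓ`] has to be connected for all `ℓ`»: the lines
of `T_ℓ(𝓛)` end at vertices of `T_ℓ(𝓛)` (`closed`) and every cut of its vertex set into two non-empty parts is crossed by
one of its lines (`conn`).  [cite: DisertoriRivasseau2000, §III.2.1 p0008:L4–24] -/
structure Labelling {n : ℕ} (t : PlaneCTS) (T : FieldTree n) where
  /-- `𝓛` on dots: dot ↦ vertex -/
  dotMap : ↥(dotAddrs t) → Fin n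
  /-- dots ↔ vertices is one to one and onto -/
  dotMap_bijective : Function.Bijective dotMap
  /-- `𝓛⁻¹` on lines, read on fields: the cross that labels the line containing the field -/
  lineMap : T.Field → ↥(crossAddrs t)
  /-- both ends of a line carry the same label -/
  lineMap_partner : ∀ f, lineMap (T.partner f) = lineMap f
  /-- every cross labels a line -/
  lineMap_surjective : Function.Surjective lineMap
  /-- distinct lines carry distinct labels -/
  eq_or_eq_partner_of_lineMap_eq : ∀ f g, lineMap f = lineMap g → g = f ∨ g = T.partner f
  /-- `T_ℓ(𝓛)` is a subgraph: its lines end at its vertices -/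
  closed : ∀ a ∈ lineAddrs t, ∀ f, ((lineMap f) : List Bool) ∈ crossesAbove t a → f.1.1 ∈ vertsAbove t dotMap a
  /-- `T_ℓ(𝓛)` is connected: every proper cut of its vertex set is crossed by one of its lines -/
  conn : ∀ a ∈ lineAddrs t, ∀ S, S ⊆ vertsAbove t dotMap a → S.Nonempty → (vertsAbove t dotMap a \ S).Nonempty →
    ∃ f, ((lineMap f) : List Bool) ∈ crossesAbove t a ∧ f.1.1 ∈ S ∧ (T.partner f).1.1 ∈ vertsAbove t dotMap a \ S

namespace Labelling

variable {n : ℕ} {t : PlaneCTS} {T : FieldTree n}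

/-- **`N_ℓ(𝒯,𝓛)`, «the number of external lines of `𝒯` hooked to `T_ℓ(𝓛)`»** (p0008:L16–17): the lines of `𝒯` with exactly
one end-vertex in `T_ℓ(𝓛)`, counted through the field at that end. [cite: DisertoriRivasseau2000, §III.2.1 p0008:L16–17] -/
def extLines (L : Labelling t T) (a : List Bool) : ℕ :=
  (Finset.univ.filter (fun f : T.Field =>
    f.1.1 ∈ vertsAbove t L.dotMap a ∧ (T.partner f).1.1 ∉ vertsAbove t L.dotMap a)).card

end Labelling

/-! ## §IV.4 Lemmas 9 and 10 — statements (rows DR1.L9 = F-049, DR1.L10 = F-050) -/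

/-- **Lemma 9** (p0015:L211–214): «For any cross `x` different from the root: `N_{ℓ⁰ₓ}(𝒯,𝓛) = N_{ℓ¹ₓ}(𝒯,𝓛) + N_{ℓ²ₓ}(𝒯,𝓛) − 2`»,
`ℓ⁰ₓ` the line going down from `x` (named by `x`), `ℓ¹ₓ, ℓ²ₓ` the two lines going up (named by the children `x ++ [false]`,
`x ++ [true]`); stated additively in `ℕ`.  PROVED below (`Lemma9ExternalLines_holds`; in fact for every cross).
[cite: DisertoriRivasseau2000, §IV.4 Lemma 9 p0015:L211–214] -/
def Lemma9ExternalLines : Prop :=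
  ∀ (t : PlaneCTS) (n : ℕ) (T : FieldTree n) (L : Labelling t T), ∀ c ∈ crossAddrs t, c ≠ [] →
    L.extLines c + 2 = L.extLines (c ++ [false]) + L.extLines (c ++ [true])

/-- **Lemma 10** (p0016:L12–16): «Let CTS be a fixed Clustering Tree Structure of order `n`. We have
`Σ_𝒯 Σ_𝓛 (1/n!) ∏_ℓ 1/N_ℓ(𝒯,𝓛) ≤ 4ⁿ`» — the sum over trees `𝒯 = (V, W)` with `n` vertices and coordination numbers in
`[1,4]` and over the labellings `𝓛` of the CTS onto `𝒯`, the product over the `2n − 2` lines `ℓ` of the CTS.  Typed over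
every finite set of (distinct) pairs `(𝒯,𝓛)`; all terms are non-negative and the type of pairs is finite (`finite_pairs`),
so this is the bound on the full sum (`lemma10_sum_univ`).  PROVED below (`Lemma10LabellingSum_holds`).
[cite: DisertoriRivasseau2000, §IV.4 Lemma 10 p0016:L12–16] -/
def Lemma10LabellingSum : Prop :=
  ∀ (n : ℕ) (t : PlaneCTS), t.dots = n → ∀ F : Finset ((T : FieldTree n) × Labelling t T),
    ∑ x ∈ F, (1 / (n.factorial : ℝ)) * ∏ a ∈ lineAddrs t, (1 / (x.2.extLines a : ℝ)) ≤ 4 ^ n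

/-! ## Proofs

### The vertex sets `T_ℓ(𝓛)` -/

namespace PlaneCTS

section VertsAbove

variable {n : ℕ} {t l r : PlaneCTS} {a c : List Bool} {δ : ↥(dotAddrs t) → Fin n}

/-- Auxiliary structural lemma (addresses, clusters, field slots). [folklore] -/
private theorem mem_vertsAbove {v : Fin n} :
    v ∈ vertsAbove t δ a ↔ ∃ d : ↥(dotAddrs t), (d : List Bool) ∈ dotsAbove t a ∧ δ d = v := by
  simp [vertsAbove]

/-- Counting through a sub-Finset of the index Finset. [folklore] -/
private theorem card_filter_univ_mem {α : Type*} [DecidableEq α] {A B : Finset α} (h : B ⊆ A) :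
    (Finset.univ.filter (fun d : ↥A => (d : α) ∈ B)).card = B.card := by
  rw [← Finset.card_map (Function.Embedding.subtype _)]
  congr 1
  ext x
  constructor
  · intro hx
    obtain ⟨⟨y, hyA⟩, hy, rfl⟩ := Finset.mem_map.1 hx
    simpa using hy
  · intro hx
    exact Finset.mem_map.2 ⟨⟨x, h hx⟩, by simpa using hx, rfl⟩

/-- Auxiliary structural lemma (addresses, clusters, field slots). [folklore] -/
private theorem dotsAbove_mono_prefix (h : a <+: c) : dotsAbove t c ⊆ dotsAbove t a := by
  intro d hd
  rw [mem_dotsAbove_iff] at hd ⊢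
  exact ⟨hd.1, h.trans hd.2⟩

/-- Auxiliary structural lemma (addresses, clusters, field slots). [folklore] -/
private theorem vertsAbove_mono (h : dotsAbove t c ⊆ dotsAbove t a) : vertsAbove t δ c ⊆ vertsAbove t δ a := by
  intro v hv
  obtain ⟨d, hd, rfl⟩ := mem_vertsAbove.1 hv
  exact mem_vertsAbove.2 ⟨d, h hd, rfl⟩

/-- Auxiliary structural lemma (addresses, clusters, field slots). [folklore] -/
private theorem vertsAbove_subset_nil : vertsAbove t δ a ⊆ vertsAbove t δ [] :=
  vertsAbove_mono (by rw [dotsAbove_nil]; exact dotsAbove_subset t a)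

/-- Auxiliary structural lemma (addresses, clusters, field slots). [folklore] -/
private theorem vertsAbove_nil_of_surjective (hδ : Function.Surjective δ) : vertsAbove t δ [] = Finset.univ := by
  ext v
  simp only [Finset.mem_univ, iff_true, mem_vertsAbove, dotsAbove_nil]
  obtain ⟨d, rfl⟩ := hδ v
  exact ⟨d, d.2, rfl⟩

/-- Auxiliary structural lemma (addresses, clusters, field slots). [folklore] -/
private theorem vertsAbove_cross_eq (hc : c ∈ crossAddrs t) :
    vertsAbove t δ c = vertsAbove t δ (c ++ [false]) ∪ vertsAbove t δ (c ++ [true]) := by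
  simp only [vertsAbove, dotsAbove_cross_eq hc, Finset.mem_union, Finset.filter_or, Finset.image_union]

/-- Auxiliary structural lemma (addresses, clusters, field slots). [folklore] -/
private theorem disjoint_vertsAbove_children (hδ : Function.Injective δ) (hc : c ∈ crossAddrs t) :
    Disjoint (vertsAbove t δ (c ++ [false])) (vertsAbove t δ (c ++ [true])) := by
  rw [vertsAbove, vertsAbove, Finset.disjoint_image hδ, Finset.disjoint_filter]
  intro d _ h1 h2
  exact Finset.disjoint_left.1 (disjoint_dotsAbove_children hc) h1 h2

/-- Auxiliary structural lemma (addresses, clusters, field slots). [folklore] -/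
private theorem vertsAbove_nonempty (ha : a ∈ nodeAddrs t) : (vertsAbove t δ a).Nonempty := by
  obtain ⟨d, hd⟩ := dotsAbove_nonempty ha
  exact ⟨δ ⟨d, dotsAbove_subset t a hd⟩, mem_vertsAbove.2 ⟨⟨d, _⟩, hd, rfl⟩⟩

/-- The dot labelling restricted to the subtree `b` above the root cross. [folklore] -/
def restrictDots (b : Bool) (δ : ↥(dotAddrs (cross l r)) → Fin n) : ↥(dotAddrs (if b then r else l)) → Fin n :=
  fun d => δ ⟨b :: (d : List Bool), cons_mem_dotAddrs_cross.2 d.2⟩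

/-- Auxiliary structural lemma (addresses, clusters, field slots). [folklore] -/
private theorem restrictDots_injective {b : Bool} {δ : ↥(dotAddrs (cross l r)) → Fin n} (hδ : Function.Injective δ) :
    Function.Injective (restrictDots b δ) := by
  intro d d' h
  have := hδ h
  simp only [Subtype.mk.injEq, List.cons.injEq, true_and] at this
  exact Subtype.ext this

/-- Auxiliary structural lemma (addresses, clusters, field slots). [folklore] -/
private theorem dotsAbove_cross_cons (b : Bool) :
    dotsAbove (cross l r) (b :: a) = (dotsAbove (if b then r else l) a).map (consAddr b) := by
  cases b <;> rfl

/-- Auxiliary structural lemma (addresses, clusters, field slots). [folklore] -/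
private theorem crossesAbove_cross_cons (b : Bool) :
    crossesAbove (cross l r) (b :: a) = (crossesAbove (if b then r else l) a).map (consAddr b) := by
  cases b <;> rfl

/-- Auxiliary structural lemma (addresses, clusters, field slots). [folklore] -/
private theorem vertsAbove_cross_cons (b : Bool) (δ : ↥(dotAddrs (cross l r)) → Fin n) :
    vertsAbove (cross l r) δ (b :: a) = vertsAbove (if b then r else l) (restrictDots b δ) a := by
  ext v
  rw [mem_vertsAbove, mem_vertsAbove]
  constructor
  · rintro ⟨d, hd, rfl⟩
    rw [dotsAbove_cross_cons] at hd
    obtain ⟨a', ha', he⟩ := mem_map_consAddr.1 hd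
    refine ⟨⟨a', dotsAbove_subset _ _ ha'⟩, ha', ?_⟩
    simp only [restrictDots]
    congr 1
    exact Subtype.ext he
  · rintro ⟨d, hd, rfl⟩
    exact ⟨⟨b :: (d : List Bool), cons_mem_dotAddrs_cross.2 d.2⟩,
      by rw [dotsAbove_cross_cons]; exact mem_map_consAddr.2 ⟨d, hd, rfl⟩, rfl⟩

end VertsAbove

end PlaneCTS

/-! ### Counting fields -/

section FieldCounts

variable {n : ℕ}

/-- The number of field slots `(v,i)`, `i < N v`, at the vertices of `V` is `Σ_{v∈V} N v` (when `N ≤ 4`). [folklore] -/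
private theorem card_rawFields (N : Fin n → ℕ) (hN : ∀ v, N v ≤ 4) (V : Finset (Fin n)) :
    (Finset.univ.filter (fun f : RawField n => ((f.2 : Fin 4) : ℕ) < N f.1 ∧ f.1 ∈ V)).card = ∑ v ∈ V, N v := by
  have h4 : ∀ m, m ≤ 4 → (∑ i : Fin 4, if (i : ℕ) < m then 1 else 0) = m := by decide
  rw [Finset.card_filter, Fintype.sum_prod_type]
  have : ∀ v : Fin n, (∑ i : Fin 4, if ((((v, i) : RawField n).2 : Fin 4) : ℕ) < N (v, i).1 ∧ (v, i).1 ∈ V then 1 else 0)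
      = if v ∈ V then N v else 0 := by
    intro v
    by_cases hv : v ∈ V
    · simp only [hv, and_true, ↓reduceIte]
      exact h4 _ (hN v)
    · simp [hv]
  simp_rw [this]
  rw [Finset.sum_ite_mem, Finset.univ_inter]

namespace FieldTree

variable (T : FieldTree n)

/-- The fields at the vertices of `V`. [folklore] -/
def fieldsAt (V : Finset (Fin n)) : Finset T.Field := Finset.univ.filter (fun f : T.Field => f.1.1 ∈ V)

/-- Auxiliary structural lemma (addresses, clusters, field slots). [folklore] -/
private theorem card_fieldsAt (V : Finset (Fin n)) : (T.fieldsAt V).card = ∑ v ∈ V, T.N v := by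
  rw [← card_rawFields T.N T.N_le_four V, fieldsAt, ← Finset.card_map (Function.Embedding.subtype _)]
  congr 1
  ext f
  simp only [Finset.mem_map, Finset.mem_filter, Finset.mem_univ, true_and, Function.Embedding.coe_subtype,
    Subtype.exists, exists_and_right, exists_eq_right]
  constructor
  · rintro ⟨h1, h2⟩; exact ⟨h1, h2⟩
  · rintro ⟨h1, h2⟩; exact ⟨h1, h2⟩

/-- Auxiliary structural lemma (addresses, clusters, field slots). [folklore] -/
private theorem partner_ne (f : T.Field) : T.partner f ≠ f := fun h => T.partner_vert_ne f (by rw [h])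

/-- Auxiliary structural lemma (addresses, clusters, field slots). [folklore] -/
private theorem partner_injective : Function.Injective T.partner :=
  Function.LeftInverse.injective T.partner_partner

/-- Auxiliary structural lemma (addresses, clusters, field slots). [folklore] -/
private theorem card_field : Fintype.card T.Field = ∑ v, T.N v := by
  rw [← Finset.card_univ, ← T.card_fieldsAt Finset.univ, fieldsAt]
  congr 1
  ext f
  simp

end FieldTree

end FieldCounts

/-! ### `N_ℓ(𝒯,𝓛)` through field counts: Lemma 9 -/

namespace Labelling

variable {n : ℕ} {t : PlaneCTS} {T : FieldTree n} (L : Labelling t T)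

/-- Shorthand: the vertex set of `T_ℓ(𝓛)`. [cite: DisertoriRivasseau2000, §III.2.1 p0008:L10–17] -/
abbrev verts (a : List Bool) : Finset (Fin n) := vertsAbove t L.dotMap a

/-- A labelled CTS has as many dots as the tree has vertices. [cite: DisertoriRivasseau2000, §III.2.1 p0008:L1–9] -/
theorem dots_eq (L : Labelling t T) : t.dots = n := by
  have h := Fintype.card_of_bijective L.dotMap_bijective
  rwa [Fintype.card_coe, Fintype.card_fin, card_dotAddrs] at h

/-- Auxiliary structural lemma (addresses, clusters, field slots). [folklore] -/
private theorem verts_nil : L.verts [] = Finset.univ := vertsAbove_nil_of_surjective L.dotMap_bijective.2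

/-- Auxiliary structural lemma (addresses, clusters, field slots). [folklore] -/
private theorem verts_cross_eq {c : List Bool} (hc : c ∈ crossAddrs t) :
    L.verts c = L.verts (c ++ [false]) ∪ L.verts (c ++ [true]) := vertsAbove_cross_eq hc

/-- Auxiliary structural lemma (addresses, clusters, field slots). [folklore] -/
private theorem disjoint_verts {c : List Bool} (hc : c ∈ crossAddrs t) :
    Disjoint (L.verts (c ++ [false])) (L.verts (c ++ [true])) :=
  disjoint_vertsAbove_children L.dotMap_bijective.1 hc

/-- Fields with both ends in `T_ℓ(𝓛)`. [folklore] -/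
def intF (a : List Bool) : Finset T.Field :=
  Finset.univ.filter (fun f : T.Field => f.1.1 ∈ L.verts a ∧ (T.partner f).1.1 ∈ L.verts a)

/-- Fields of the external lines of `T_ℓ(𝓛)` at their inner end. [cite: DisertoriRivasseau2000, §III.2.1 p0008:L16–17] -/
def extF (a : List Bool) : Finset T.Field :=
  Finset.univ.filter (fun f : T.Field => f.1.1 ∈ L.verts a ∧ (T.partner f).1.1 ∉ L.verts a)

/-- Fields whose line is labelled by a cross above `a`. [folklore] -/
def labF (a : List Bool) : Finset T.Field :=
  Finset.univ.filter (fun f : T.Field => ((L.lineMap f) : List Bool) ∈ crossesAbove t a)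

/-- Fields going from the first to the second subtree above the cross `c`. [folklore] -/
def X01 (c : List Bool) : Finset T.Field :=
  Finset.univ.filter (fun f : T.Field => f.1.1 ∈ L.verts (c ++ [false]) ∧ (T.partner f).1.1 ∈ L.verts (c ++ [true]))

/-- Auxiliary structural lemma (addresses, clusters, field slots). [folklore] -/
private theorem extLines_eq_card (a : List Bool) : L.extLines a = (L.extF a).card := rfl

/-- Auxiliary structural lemma (addresses, clusters, field slots). [folklore] -/
private theorem card_intF_add_card_extF (a : List Bool) :
    (L.intF a).card + (L.extF a).card = ∑ v ∈ L.verts a, T.N v := by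
  rw [← T.card_fieldsAt, intF, extF, FieldTree.fieldsAt, ← Finset.filter_filter, ← Finset.filter_filter,
    Finset.card_filter_add_card_filter_not]

/-- The fibres of `lineMap` are the lines: two fields each. [cite: DisertoriRivasseau2000, §III.2.1 p0008:L4–9] -/
theorem card_fibre_lineMap (c : ↥(crossAddrs t)) :
    (Finset.univ.filter (fun f : T.Field => L.lineMap f = c)).card = 2 := by
  obtain ⟨f₀, hf₀⟩ := L.lineMap_surjective c
  have : Finset.univ.filter (fun f : T.Field => L.lineMap f = c) = {f₀, T.partner f₀} := by
    ext g
    simp only [Finset.mem_filter, Finset.mem_univ, true_and, Finset.mem_insert, Finset.mem_singleton]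
    constructor
    · intro hg
      exact L.eq_or_eq_partner_of_lineMap_eq f₀ g (hf₀.trans hg.symm)
    · rintro (rfl | rfl)
      · exact hf₀
      · rw [L.lineMap_partner, hf₀]
  rw [this, Finset.card_pair (T.partner_ne f₀).symm]

/-- Auxiliary structural lemma (addresses, clusters, field slots). [folklore] -/
private theorem card_labF (a : List Bool) : (L.labF a).card = 2 * (crossesAbove t a).card := by
  have H : ((L.labF a : Finset T.Field) : Set T.Field).MapsTo (fun f : T.Field => ((L.lineMap f) : List Bool))
      ((crossesAbove t a : Finset (List Bool)) : Set (List Bool)) := by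
    intro f hf
    exact Finset.mem_coe.2 (Finset.mem_filter.1 (Finset.mem_coe.1 hf)).2
  rw [Finset.card_eq_sum_card_fiberwise H, Finset.sum_congr rfl (g := fun _ => 2)]
  · rw [Finset.sum_const, smul_eq_mul, mul_comm]
  · intro c hc
    have hc' : c ∈ crossAddrs t := crossesAbove_subset t a hc
    rw [← L.card_fibre_lineMap ⟨c, hc'⟩]
    congr 1
    ext f
    simp only [labF, Finset.mem_filter, Finset.mem_univ, true_and]
    constructor
    · rintro ⟨-, h⟩; exact Subtype.ext h
    · intro h; rw [h]; exact ⟨hc, rfl⟩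

/-- The lines of `T_ℓ(𝓛)` are internal to it (the subgraph condition). [cite: DisertoriRivasseau2000, §III.2.1 p0008:L10–17] -/
theorem labF_subset_intF {a : List Bool} (ha : a ∈ nodeAddrs t) : L.labF a ⊆ L.intF a := by
  intro f hf
  simp only [labF, intF, Finset.mem_filter, Finset.mem_univ, true_and] at hf ⊢
  by_cases h0 : a = []
  · subst h0
    rw [L.verts_nil]
    exact ⟨Finset.mem_univ _, Finset.mem_univ _⟩
  · have hline : a ∈ lineAddrs t := Finset.mem_erase.2 ⟨h0, ha⟩
    refine ⟨L.closed a hline f hf, ?_⟩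
    have hf' : ((L.lineMap (T.partner f)) : List Bool) ∈ crossesAbove t a := by rw [L.lineMap_partner]; exact hf
    exact L.closed a hline (T.partner f) hf'

/-- Internal fields of a cross cluster: those of the two sub-clusters plus twice the crossing ones. [folklore] -/
private theorem card_intF_cross {c : List Bool} (hc : c ∈ crossAddrs t) :
    (L.intF c).card = (L.intF (c ++ [false])).card + (L.intF (c ++ [true])).card + 2 * (L.X01 c).card := by
  have hV := L.verts_cross_eq hc
  have hd := L.disjoint_verts hc
  have hX : (Finset.univ.filter (fun f : T.Field =>
      f.1.1 ∈ L.verts (c ++ [true]) ∧ (T.partner f).1.1 ∈ L.verts (c ++ [false]))).card = (L.X01 c).card := by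
    rw [X01, ← Finset.card_map ⟨T.partner, T.partner_injective⟩]
    congr 1
    ext f
    rw [Finset.mem_map, Finset.mem_filter]
    constructor
    · rintro ⟨g, hg, rfl⟩
      obtain ⟨-, h1, h2⟩ := Finset.mem_filter.1 hg
      refine ⟨Finset.mem_univ _, h2, ?_⟩
      show (T.partner (T.partner g)).1.1 ∈ _
      rw [T.partner_partner]; exact h1
    · rintro ⟨-, h1, h2⟩
      refine ⟨T.partner f, Finset.mem_filter.2 ⟨Finset.mem_univ _, h2, ?_⟩, T.partner_partner f⟩
      show (T.partner (T.partner f)).1.1 ∈ _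
      rw [T.partner_partner]; exact h1
  rw [two_mul, ← add_assoc]
  nth_rewrite 2 [← hX]
  simp only [intF, X01, Finset.card_filter]
  rw [← Finset.sum_add_distrib, ← Finset.sum_add_distrib, ← Finset.sum_add_distrib]
  refine Finset.sum_congr rfl fun f _ => ?_
  have h1 : ∀ v, v ∈ L.verts c ↔ v ∈ L.verts (c ++ [false]) ∨ v ∈ L.verts (c ++ [true]) := fun v => by
    rw [hV, Finset.mem_union]
  have h2 : ∀ v, v ∈ L.verts (c ++ [false]) → v ∉ L.verts (c ++ [true]) := fun v hv =>
    Finset.disjoint_left.1 hd hv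
  by_cases a0 : f.1.1 ∈ L.verts (c ++ [false])
  · have a1 : f.1.1 ∉ L.verts (c ++ [true]) := h2 _ a0
    by_cases b0 : (T.partner f).1.1 ∈ L.verts (c ++ [false])
    · have b1 : (T.partner f).1.1 ∉ L.verts (c ++ [true]) := h2 _ b0
      simp [h1, a0, a1, b0, b1]
    · by_cases b1 : (T.partner f).1.1 ∈ L.verts (c ++ [true]) <;> simp [h1, a0, a1, b0, b1]
  · by_cases a1 : f.1.1 ∈ L.verts (c ++ [true])
    · by_cases b0 : (T.partner f).1.1 ∈ L.verts (c ++ [false])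
      · have b1 : (T.partner f).1.1 ∉ L.verts (c ++ [true]) := h2 _ b0
        simp [h1, a0, a1, b0, b1]
      · by_cases b1 : (T.partner f).1.1 ∈ L.verts (c ++ [true]) <;> simp [h1, a0, a1, b0, b1]
    · simp [h1, a0, a1]

/-- Some line of `𝒯` joins the two subtrees above a cross (connectedness). [cite: DisertoriRivasseau2000, §III.2.1 p0008:L14–15] -/
theorem X01_nonempty {c : List Bool} (hc : c ∈ crossAddrs t) : (L.X01 c).Nonempty := by
  have hc0 : c ++ [false] ∈ nodeAddrs t := append_mem_nodeAddrs_of_mem_crossAddrs false hc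
  have hc1 : c ++ [true] ∈ nodeAddrs t := append_mem_nodeAddrs_of_mem_crossAddrs true hc
  have hne0 : (L.verts (c ++ [false])).Nonempty := vertsAbove_nonempty hc0
  have hne1 : (L.verts (c ++ [true])).Nonempty := vertsAbove_nonempty hc1
  have hV := L.verts_cross_eq hc
  have hd := L.disjoint_verts hc
  have hsdiff : L.verts c \ L.verts (c ++ [false]) = L.verts (c ++ [true]) := by
    rw [hV, Finset.union_sdiff_cancel_left hd]
  by_cases h0 : c = []
  · subst h0
    have huniv : L.verts ([] ++ [false]) ∪ L.verts ([] ++ [true]) = Finset.univ := by rw [← hV, L.verts_nil]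
    obtain ⟨f, hf1, hf2⟩ := T.connected (L.verts ([] ++ [false])) hne0 (by
      rw [Finset.compl_eq_univ_sdiff, ← L.verts_nil, hsdiff]; exact hne1)
    refine ⟨f, Finset.mem_filter.2 ⟨Finset.mem_univ _, hf1, ?_⟩⟩
    have hmem : (T.partner f).1.1 ∈ L.verts ([] ++ [false]) ∪ L.verts ([] ++ [true]) := by
      rw [huniv]; exact Finset.mem_univ _
    rcases Finset.mem_union.1 hmem with h | h
    · exact absurd h hf2
    · exact h
  · have hline : c ∈ lineAddrs t := Finset.mem_erase.2 ⟨h0, Finset.mem_union_right _ hc⟩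
    obtain ⟨f, -, hf1, hf2⟩ := L.conn c hline (L.verts (c ++ [false]))
      (by change L.verts (c ++ [false]) ⊆ L.verts c; rw [hV]; exact Finset.subset_union_left) hne0
      (by change (L.verts c \ L.verts (c ++ [false])).Nonempty; rw [hsdiff]; exact hne1)
    have hf2' : (T.partner f).1.1 ∈ L.verts (c ++ [true]) := by rw [← hsdiff]; exact hf2
    exact ⟨f, Finset.mem_filter.2 ⟨Finset.mem_univ _, hf1, hf2'⟩⟩

/-- **`N_ℓ` depends only on `V` and the dot labelling**: the fields internal to `T_ℓ(𝓛)` are exactly the `2·#{crosses above ℓ}`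
ends of its own lines (top-down induction from the root, where all `2(n−1)` fields are internal).
[cite: DisertoriRivasseau2000, §IV.4 Lemma 10 (proof) p0016:L21–25] -/
theorem card_intF_eq : ∀ (k : ℕ) (a : List Bool), a ∈ nodeAddrs t → a.length = k →
    (L.intF a).card = 2 * (crossesAbove t a).card := by
  intro k
  induction k with
  | zero =>
    intro a ha hlen
    obtain rfl : a = [] := List.eq_nil_of_length_eq_zero hlen
    have h1 : L.intF [] = Finset.univ := by
      ext f
      simp only [intF, Finset.mem_filter, Finset.mem_univ, true_and, iff_true]
      rw [L.verts_nil]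
      exact ⟨Finset.mem_univ _, Finset.mem_univ _⟩
    rw [h1, Finset.card_univ, T.card_field, crossesAbove_nil]
    have h2 := T.sum_N
    have h3 := card_crossAddrs_add_one t
    have h4 := L.dots_eq
    omega
  | succ k ih =>
    intro a ha hlen
    have h0 : a ≠ [] := by rintro rfl; simp at hlen
    obtain ⟨c, hc, b, rfl⟩ := exists_parent_of_mem_lineAddrs (Finset.mem_erase.2 ⟨h0, ha⟩)
    have hcn : c ∈ nodeAddrs t := Finset.mem_union_right _ hc
    have hck : c.length = k := by simp at hlen; omega
    have hP := ih c hcn hck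
    have hsq := L.card_intF_cross hc
    have hl0 := Finset.card_le_card (L.labF_subset_intF (append_mem_nodeAddrs_of_mem_crossAddrs false hc))
    have hl1 := Finset.card_le_card (L.labF_subset_intF (append_mem_nodeAddrs_of_mem_crossAddrs true hc))
    rw [L.card_labF] at hl0 hl1
    have hx := Finset.card_pos.2 (L.X01_nonempty hc)
    have hcr := card_crossesAbove_cross hc
    cases b <;> omega

/-- Exactly one line of `𝒯` joins the two subtrees above a cross. [cite: DisertoriRivasseau2000, §IV.4 Lemma 9 (proof) p0016:L1–6] -/
theorem card_X01 {c : List Bool} (hc : c ∈ crossAddrs t) : (L.X01 c).card = 1 := by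
  have hcn : c ∈ nodeAddrs t := Finset.mem_union_right _ hc
  have hP := L.card_intF_eq _ c hcn rfl
  have hP0 := L.card_intF_eq _ _ (append_mem_nodeAddrs_of_mem_crossAddrs false hc) rfl
  have hP1 := L.card_intF_eq _ _ (append_mem_nodeAddrs_of_mem_crossAddrs true hc) rfl
  have hsq := L.card_intF_cross hc
  have hx := Finset.card_pos.2 (L.X01_nonempty hc)
  have hcr := card_crossesAbove_cross hc
  omega

/-- Auxiliary structural lemma (addresses, clusters, field slots). [folklore] -/
private theorem labF_eq_intF {a : List Bool} (ha : a ∈ nodeAddrs t) : L.labF a = L.intF a :=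
  Finset.eq_of_subset_of_card_le (L.labF_subset_intF ha) (by rw [L.card_labF, L.card_intF_eq _ a ha rfl])

/-- **Orientation**: a line of `𝒯` joining the two subtrees above the cross `x` is the line labelled by `x`.
[cite: DisertoriRivasseau2000, §IV.4 Lemma 9 (proof) p0016:L1–6] -/
theorem lineMap_eq_of_mem_X01 {c : List Bool} (hc : c ∈ crossAddrs t) {f : T.Field} (hf : f ∈ L.X01 c) :
    ((L.lineMap f) : List Bool) = c := by
  have hcn : c ∈ nodeAddrs t := Finset.mem_union_right _ hc
  obtain ⟨hf0, hf1⟩ := (Finset.mem_filter.1 hf).2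
  have hint : f ∈ L.intF c := by
    refine Finset.mem_filter.2 ⟨Finset.mem_univ _, ?_, ?_⟩
    · rw [L.verts_cross_eq hc]; exact Finset.mem_union_left _ hf0
    · rw [L.verts_cross_eq hc]; exact Finset.mem_union_right _ hf1
  rw [← L.labF_eq_intF hcn] at hint
  have hlab : ((L.lineMap f) : List Bool) ∈ crossesAbove t c := (Finset.mem_filter.1 hint).2
  rw [crossesAbove_cross_eq hc, Finset.mem_insert, Finset.mem_union] at hlab
  rcases hlab with h | h | h
  · exact h
  · exfalso
    have hline := append_mem_lineAddrs_of_mem_crossAddrs (t := t) false hc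
    have := L.closed _ hline (T.partner f) (by rw [L.lineMap_partner]; exact h)
    exact Finset.disjoint_left.1 (L.disjoint_verts hc) this hf1
  · exfalso
    have hline := append_mem_lineAddrs_of_mem_crossAddrs (t := t) true hc
    have := L.closed _ hline f h
    exact Finset.disjoint_left.1 (L.disjoint_verts hc) hf0 this

/-- Auxiliary structural lemma (addresses, clusters, field slots). [folklore] -/
private theorem exists_oriented {c : List Bool} (hc : c ∈ crossAddrs t) :
    ∃ f : T.Field, ((L.lineMap f) : List Bool) = c ∧ f ∈ L.X01 c := by
  obtain ⟨f, hf⟩ := L.X01_nonempty hc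
  exact ⟨f, L.lineMap_eq_of_mem_X01 hc hf, hf⟩

/-- **`N_ℓ(𝒯,𝓛) = Σ_{v ∈ T_ℓ} N_v − 2·#{crosses above ℓ}`** — it depends on `𝒯, 𝓛` only through `V` and the dot labelling.
[cite: DisertoriRivasseau2000, §IV.4 Lemma 10 (proof) p0016:L21–25] -/
theorem extLines_add {a : List Bool} (ha : a ∈ nodeAddrs t) :
    L.extLines a + 2 * (crossesAbove t a).card = ∑ v ∈ L.verts a, T.N v := by
  rw [← L.card_intF_eq _ a ha rfl, add_comm, extLines_eq_card]
  exact L.card_intF_add_card_extF a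

/-- Lemma 9 for every cross (the root included). [cite: DisertoriRivasseau2000, §IV.4 Lemma 9 p0015:L211–214] -/
theorem extLines_cross {c : List Bool} (hc : c ∈ crossAddrs t) :
    L.extLines c + 2 = L.extLines (c ++ [false]) + L.extLines (c ++ [true]) := by
  have h := L.extLines_add (Finset.mem_union_right _ hc)
  have h0 := L.extLines_add (append_mem_nodeAddrs_of_mem_crossAddrs false hc)
  have h1 := L.extLines_add (append_mem_nodeAddrs_of_mem_crossAddrs true hc)
  have hsum : ∑ v ∈ L.verts c, T.N v =
      ∑ v ∈ L.verts (c ++ [false]), T.N v + ∑ v ∈ L.verts (c ++ [true]), T.N v := by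
    rw [L.verts_cross_eq hc, Finset.sum_union (L.disjoint_verts hc)]
  have hcr := card_crossesAbove_cross hc
  omega

/-- Every `N_ℓ(𝒯,𝓛)` is at least `1`. [cite: DisertoriRivasseau2000, §IV.4 Lemma 10 (proof) p0016:L36–41] -/
theorem extLines_pos {a : List Bool} (ha : a ∈ lineAddrs t) : 0 < L.extLines a := by
  obtain ⟨c, hc, b, rfl⟩ := exists_parent_of_mem_lineAddrs ha
  obtain ⟨f, hf⟩ := L.X01_nonempty hc
  obtain ⟨hf0, hf1⟩ := (Finset.mem_filter.1 hf).2
  rw [extLines_eq_card, Finset.card_pos]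
  cases b
  · exact ⟨f, Finset.mem_filter.2 ⟨Finset.mem_univ _, hf0, Finset.disjoint_right.1 (L.disjoint_verts hc) hf1⟩⟩
  · refine ⟨T.partner f, Finset.mem_filter.2 ⟨Finset.mem_univ _, hf1, ?_⟩⟩
    rw [T.partner_partner]
    exact Finset.disjoint_left.1 (L.disjoint_verts hc) hf0

end Labelling

/-- **Lemma 9 of [DR1] holds.** [cite: DisertoriRivasseau2000, §IV.4 Lemma 9 p0015:L211–214] -/
theorem Lemma9ExternalLines_holds : Lemma9ExternalLines :=
  fun _ _ _ L _ hc _ => L.extLines_cross hc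

/-! ### Lemma 10: counting the Wick contractions compatible with `(V, 𝓛ₒ)`

For a fixed list of coordination numbers (coded by `g v = N_v − 1`) and a fixed dot labelling `δ`, an assignment to every
cross `x` of an ordered pair of field slots (one at a vertex of the first subtree above `x`, one at a vertex of the second),
all `2n − 2` slots distinct, is what a pair (Wick contraction `W`, line labelling `𝓛ₓ`) amounts to (`lineEnds` below is
injective); their number is at most `∏_ℓ N_ℓ(V,𝓛ₒ)` — «starting from the n dots in CTS with their N_v hooked fields, and going
down towards the root … for a cross x, we have to choose one external field in T_{ℓ¹ₓ} and one in T_{ℓ²ₓ}» (p0016:L35–44). -/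

namespace PlaneCTS

section ValidAssignments

open Classical

variable {n : ℕ}

/-- The `2·#crosses` field slots used by an assignment of oriented line ends. [folklore] -/
def ent {s : PlaneCTS} (E : ↥(crossAddrs s) → RawField n × RawField n) (p : ↥(crossAddrs s) × Bool) : RawField n :=
  if p.2 then (E p.1).2 else (E p.1).1

/-- Oriented line-end assignments compatible with the coordination numbers `g v + 1` and the dot labelling `δ`: for each
cross an active slot at a vertex of the first subtree and one at a vertex of the second subtree, all slots distinct.
[cite: DisertoriRivasseau2000, §IV.4 Lemma 10 (proof) p0016:L33–44] -/
def Valid (s : PlaneCTS) (g : Fin n → Fin 4) (δ : ↥(dotAddrs s) → Fin n)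
    (E : ↥(crossAddrs s) → RawField n × RawField n) : Prop :=
  (∀ c : ↥(crossAddrs s),
    ((((E c).1.2 : Fin 4) : ℕ) < (g (E c).1.1 : ℕ) + 1 ∧ (E c).1.1 ∈ vertsAbove s δ ((c : List Bool) ++ [false])) ∧
    ((((E c).2.2 : Fin 4) : ℕ) < (g (E c).2.1 : ℕ) + 1 ∧ (E c).2.1 ∈ vertsAbove s δ ((c : List Bool) ++ [true]))) ∧
  Function.Injective (ent E)

/-- `N_ℓ(V, 𝓛ₒ) = Σ_{v ∈ T_ℓ} N_v − 2·#{crosses above ℓ}`. [cite: DisertoriRivasseau2000, §IV.4 Lemma 10 (proof) p0016:L21–25] -/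
def M (s : PlaneCTS) (g : Fin n → Fin 4) (δ : ↥(dotAddrs s) → Fin n) (a : List Bool) : ℕ :=
  (∑ v ∈ vertsAbove s δ a, ((g v : ℕ) + 1)) - 2 * (crossesAbove s a).card

variable {l r : PlaneCTS} {g : Fin n → Fin 4} {δ : ↥(dotAddrs (cross l r)) → Fin n}

/-- The crosses of a subtree, seen in the whole tree. [folklore] -/
def inCross (l r : PlaneCTS) (b : Bool) (c : ↥(crossAddrs (if b then r else l))) : ↥(crossAddrs (cross l r)) :=
  ⟨b :: (c : List Bool), cons_mem_crossAddrs_cross.2 c.2⟩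

/-- The root cross. [folklore] -/
def rootCross (l r : PlaneCTS) : ↥(crossAddrs (cross l r)) := ⟨[], nil_mem_crossAddrs_cross⟩

/-- Auxiliary structural lemma (addresses, clusters, field slots). [folklore] -/
private theorem inCross_injective (b : Bool) : Function.Injective (inCross l r b) := by
  intro c c' h
  simp only [inCross, Subtype.mk.injEq, List.cons.injEq, true_and] at h
  exact Subtype.ext h

/-- Auxiliary structural lemma (addresses, clusters, field slots). [folklore] -/
private theorem M_cross_cons (b : Bool) (a : List Bool) :
    M (cross l r) g δ (b :: a) = M (if b then r else l) g (restrictDots b δ) a := by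
  rw [M, M, vertsAbove_cross_cons, crossesAbove_cross_cons, Finset.card_map]

/-- Auxiliary structural lemma (addresses, clusters, field slots). [folklore] -/
private theorem ent_comp_inCross (b : Bool) (E : ↥(crossAddrs (cross l r)) → RawField n × RawField n)
    (p : ↥(crossAddrs (if b then r else l)) × Bool) :
    ent (fun c => E (inCross l r b c)) p = ent E (inCross l r b p.1, p.2) := by
  rcases p with ⟨c, b'⟩
  cases b' <;> rfl

/-- Auxiliary structural lemma (addresses, clusters, field slots). [folklore] -/
private theorem valid_restrict (b : Bool) {E : ↥(crossAddrs (cross l r)) → RawField n × RawField n}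
    (hE : Valid (cross l r) g δ E) : Valid (if b then r else l) g (restrictDots b δ) (fun c => E (inCross l r b c)) := by
  refine ⟨fun c => ?_, fun p p' h => ?_⟩
  · have h := hE.1 (inCross l r b c)
    have e0 : ((inCross l r b c : ↥(crossAddrs (cross l r))) : List Bool) ++ [false] = b :: ((c : List Bool) ++ [false]) := rfl
    have e1 : ((inCross l r b c : ↥(crossAddrs (cross l r))) : List Bool) ++ [true] = b :: ((c : List Bool) ++ [true]) := rfl
    rw [e0, e1, vertsAbove_cross_cons, vertsAbove_cross_cons] at h
    exact h
  · rw [ent_comp_inCross, ent_comp_inCross] at h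
    have h' := hE.2 h
    simp only [Prod.mk.injEq] at h'
    exact Prod.ext (inCross_injective b h'.1) h'.2

/-- The slots still free in subtree `b` at the root cross: active slots at its vertices not used by its own crosses. [folklore] -/
def avail (g : Fin n → Fin 4) (δ : ↥(dotAddrs (cross l r)) → Fin n) (b : Bool)
    (Eb : ↥(crossAddrs (if b then r else l)) → RawField n × RawField n) : Finset (RawField n) :=
  (Finset.univ.filter (fun f : RawField n => ((f.2 : Fin 4) : ℕ) < (g f.1 : ℕ) + 1 ∧ f.1 ∈ vertsAbove (cross l r) δ [b])) \
    Finset.univ.image (ent Eb)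

/-- Auxiliary structural lemma (addresses, clusters, field slots). [folklore] -/
private theorem card_avail (b : Bool) {Eb : ↥(crossAddrs (if b then r else l)) → RawField n × RawField n}
    (hEb : Valid (if b then r else l) g (restrictDots b δ) Eb) : (avail g δ b Eb).card = M (cross l r) g δ [b] := by
  have hsub : Finset.univ.image (ent Eb) ⊆ Finset.univ.filter (fun f : RawField n =>
      ((f.2 : Fin 4) : ℕ) < (g f.1 : ℕ) + 1 ∧ f.1 ∈ vertsAbove (cross l r) δ [b]) := by
    intro x hx
    obtain ⟨p, -, rfl⟩ := Finset.mem_image.1 hx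
    rw [Finset.mem_filter]
    refine ⟨Finset.mem_univ _, ?_⟩
    have hV : ∀ a, vertsAbove (if b then r else l) (restrictDots b δ) a ⊆ vertsAbove (cross l r) δ [b] := by
      intro a
      rw [show ([b] : List Bool) = b :: [] from rfl, vertsAbove_cross_cons]
      exact vertsAbove_subset_nil
    rcases p with ⟨c, b'⟩
    have h := hEb.1 c
    cases b'
    · exact ⟨h.1.1, hV _ h.1.2⟩
    · exact ⟨h.2.1, hV _ h.2.2⟩
  rw [avail, Finset.card_sdiff_of_subset hsub, Finset.card_image_of_injective _ hEb.2, Finset.card_univ,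
    Fintype.card_prod, Fintype.card_bool, Fintype.card_coe,
    card_rawFields (fun v => (g v : ℕ) + 1) (fun v => by have := (g v).2; omega), M,
    show ([b] : List Bool) = b :: [] from rfl, crossesAbove_cross_cons, Finset.card_map, crossesAbove_nil, mul_comm]

/-- **At most `∏_ℓ N_ℓ(V,𝓛ₒ)` compatible assignments** (Wick contractions with their line labels).
[cite: DisertoriRivasseau2000, §IV.4 Lemma 10 (proof) p0016:L33–44] -/
theorem card_valid_le : ∀ (s : PlaneCTS) (g : Fin n → Fin 4) (δ : ↥(dotAddrs s) → Fin n), Function.Injective δ →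
    (Finset.univ.filter (Valid s g δ)).card ≤ ∏ a ∈ lineAddrs s, M s g δ a
  | dot, g, δ, _ => by
      rw [lineAddrs_dot, Finset.prod_empty]
      refine (Finset.card_filter_le _ _).trans ?_
      rw [Finset.card_univ, Fintype.card_fun, Fintype.card_coe, crossAddrs_dot, Finset.card_empty, pow_zero]
  | cross l r, g, δ, hδ => by
      have ihl := card_valid_le l g (restrictDots false δ) (restrictDots_injective hδ)
      have ihr := card_valid_le r g (restrictDots true δ) (restrictDots_injective hδ)
      set VS := Finset.univ.filter (Valid (cross l r) g δ) with hVS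
      set VL := Finset.univ.filter (Valid l g (restrictDots false δ)) with hVL
      set VR := Finset.univ.filter (Valid r g (restrictDots true δ)) with hVR
      -- restriction to the two subtrees
      let ρ : (↥(crossAddrs (cross l r)) → RawField n × RawField n) →
          (↥(crossAddrs l) → RawField n × RawField n) × (↥(crossAddrs r) → RawField n × RawField n) :=
        fun E => (fun c => E (inCross l r false c), fun c => E (inCross l r true c))
      have hmaps : ∀ E ∈ VS, ρ E ∈ VL ×ˢ VR := by
        intro E hE
        have hv : Valid (cross l r) g δ E := (Finset.mem_filter.1 hE).2
        exact Finset.mem_product.2 ⟨Finset.mem_filter.2 ⟨Finset.mem_univ _, valid_restrict false hv⟩,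
          Finset.mem_filter.2 ⟨Finset.mem_univ _, valid_restrict true hv⟩⟩
      -- each fibre of ρ injects, by the root value, into avail × avail
      have hfib : ∀ q ∈ VL ×ˢ VR, (VS.filter (fun E => ρ E = q)).card ≤
          M (cross l r) g δ [false] * M (cross l r) g δ [true] := by
        intro q hq
        obtain ⟨hq1, hq2⟩ := Finset.mem_product.1 hq
        have hv1 : Valid l g (restrictDots false δ) q.1 := (Finset.mem_filter.1 hq1).2
        have hv2 : Valid r g (restrictDots true δ) q.2 := (Finset.mem_filter.1 hq2).2
        rw [← card_avail false hv1, ← card_avail true hv2, ← Finset.card_product]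
        refine Finset.card_le_card_of_injOn (fun E => E (rootCross l r)) ?_ ?_
        · intro E hE
          rw [Finset.coe_filter] at hE
          obtain ⟨hE, hρ⟩ := hE
          have hv : Valid (cross l r) g δ E := (Finset.mem_filter.1 hE).2
          have h0 := hv.1 (rootCross l r)
          rw [Finset.mem_coe, Finset.mem_product]
          constructor
          · rw [avail, Finset.mem_sdiff, Finset.mem_filter]
            refine ⟨⟨Finset.mem_univ _, h0.1.1, h0.1.2⟩, fun him => ?_⟩
            obtain ⟨p, -, hp⟩ := Finset.mem_image.1 him
            have : ent E (inCross l r false p.1, p.2) = ent E (rootCross l r, false) := by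
              rw [← hρ] at hp; rw [← ent_comp_inCross]; exact hp
            have := congrArg Prod.fst (hv.2 this)
            simp [inCross, rootCross] at this
          · rw [avail, Finset.mem_sdiff, Finset.mem_filter]
            refine ⟨⟨Finset.mem_univ _, h0.2.1, h0.2.2⟩, fun him => ?_⟩
            obtain ⟨p, -, hp⟩ := Finset.mem_image.1 him
            have : ent E (inCross l r true p.1, p.2) = ent E (rootCross l r, true) := by
              rw [← hρ] at hp; rw [← ent_comp_inCross]; exact hp
            have := congrArg Prod.fst (hv.2 this)
            simp [inCross, rootCross] at this
        · intro E hE E' hE' hEE'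
          rw [Finset.coe_filter] at hE hE'
          obtain ⟨-, hρ⟩ := hE
          obtain ⟨-, hρ'⟩ := hE'
          funext c
          rcases c with ⟨c, hc⟩
          cases c with
          | nil => exact hEE'
          | cons b c =>
            have hc' : c ∈ crossAddrs (if b then r else l) := cons_mem_crossAddrs_cross.1 hc
            cases b
            · have h1 := congrFun (congrArg Prod.fst hρ) ⟨c, hc'⟩
              have h2 := congrFun (congrArg Prod.fst hρ') ⟨c, hc'⟩
              exact h1.trans h2.symm
            · have h1 := congrFun (congrArg Prod.snd hρ) ⟨c, hc'⟩
              have h2 := congrFun (congrArg Prod.snd hρ') ⟨c, hc'⟩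
              exact h1.trans h2.symm
      -- assemble
      calc VS.card = ∑ q ∈ VL ×ˢ VR, (VS.filter (fun E => ρ E = q)).card :=
            Finset.card_eq_sum_card_fiberwise (fun E hE => Finset.mem_coe.2 (hmaps E (Finset.mem_coe.1 hE)))
        _ ≤ ∑ q ∈ VL ×ˢ VR, M (cross l r) g δ [false] * M (cross l r) g δ [true] := Finset.sum_le_sum hfib
        _ = VL.card * VR.card * (M (cross l r) g δ [false] * M (cross l r) g δ [true]) := by
            rw [Finset.sum_const, smul_eq_mul, Finset.card_product]
        _ ≤ (∏ a ∈ lineAddrs l, M (cross l r) g δ (false :: a)) * (∏ a ∈ lineAddrs r, M (cross l r) g δ (true :: a)) *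
              (M (cross l r) g δ [false] * M (cross l r) g δ [true]) := by
            refine Nat.mul_le_mul_right _ (Nat.mul_le_mul ?_ ?_)
            · refine ihl.trans_eq (Finset.prod_congr rfl fun a _ => ?_)
              exact (M_cross_cons false a).symm
            · refine ihr.trans_eq (Finset.prod_congr rfl fun a _ => ?_)
              exact (M_cross_cons true a).symm
        _ = ∏ a ∈ lineAddrs (cross l r), M (cross l r) g δ a := by
            rw [prod_lineAddrs_cross]; ring

end ValidAssignments

end PlaneCTS

/-! ### Lemma 10: the injection `(𝒯,𝓛) ↦ (V, 𝓛ₒ, W, 𝓛ₓ)` and the bound -/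

section LemmaTen

open Classical

variable {n : ℕ} {t : PlaneCTS}

namespace FieldTree

/-- Two trees with the same coordination numbers and the same Wick contraction (read on raw slots) are equal. [folklore] -/
private theorem ext' {T T' : FieldTree n} (hN : T.N = T'.N)
    (hp : ∀ f : T.Field, ((T.partner f) : RawField n) = (T'.partner ⟨f.1, by rw [← hN]; exact f.2⟩ : RawField n)) :
    T = T' := by
  rcases T with ⟨N, h1, h2, p, hp1, hp2, hs, hc⟩
  rcases T' with ⟨N', h1', h2', p', hp1', hp2', hs', hc'⟩
  cases hN
  have : p = p' := funext fun f => Subtype.ext (hp f)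
  cases this
  rfl

/-- The coordination numbers coded in `Fin 4` (`N_v − 1`). [folklore] -/
def codeN (T : FieldTree n) (v : Fin n) : Fin 4 :=
  ⟨T.N v - 1, by have := T.N_le_four v; have := T.one_le_N v; omega⟩

/-- Auxiliary structural lemma (addresses, clusters, field slots). [folklore] -/
private theorem codeN_add_one (T : FieldTree n) (v : Fin n) : (T.codeN v : ℕ) + 1 = T.N v := by
  have := T.one_le_N v
  simp only [codeN]
  omega

end FieldTree

namespace Labelling

variable {T : FieldTree n} (L : Labelling t T)

/-- Two labellings with the same dot and line maps are equal. [folklore] -/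
private theorem ext' {L L' : Labelling t T} (hd : L.dotMap = L'.dotMap) (hl : L.lineMap = L'.lineMap) : L = L' := by
  rcases L with ⟨d, _, m, _, _, _, _, _⟩
  rcases L' with ⟨d', _, m', _, _, _, _, _⟩
  cases hd
  cases hl
  rfl

/-- The end, in the first subtree above `x`, of the line labelled by the cross `x`. [cite: DisertoriRivasseau2000, §IV.4 p0015:L207–209] -/
def orient (c : ↥(crossAddrs t)) : T.Field := Classical.choose (L.exists_oriented c.2)

/-- Auxiliary structural lemma (addresses, clusters, field slots). [folklore] -/
private theorem orient_spec (c : ↥(crossAddrs t)) :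
    ((L.lineMap (L.orient c)) : List Bool) = c ∧ L.orient c ∈ L.X01 c :=
  Classical.choose_spec (L.exists_oriented c.2)

/-- Auxiliary structural lemma (addresses, clusters, field slots). [folklore] -/
private theorem lineMap_orient (c : ↥(crossAddrs t)) : L.lineMap (L.orient c) = c := Subtype.ext (L.orient_spec c).1

/-- Auxiliary structural lemma (addresses, clusters, field slots). [folklore] -/
private theorem eq_orient_or (f : T.Field) :
    f = L.orient (L.lineMap f) ∨ f = T.partner (L.orient (L.lineMap f)) :=
  L.eq_or_eq_partner_of_lineMap_eq _ _ (L.lineMap_orient (L.lineMap f))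

/-- `(W, 𝓛ₓ)` read as oriented line ends per cross. [cite: DisertoriRivasseau2000, §IV.4 Lemma 10 (proof) p0016:L33–44] -/
def lineEnds (c : ↥(crossAddrs t)) : RawField n × RawField n :=
  (((L.orient c) : RawField n), ((T.partner (L.orient c)) : RawField n))

/-- The oriented line ends of a labelled tree form a valid assignment. [cite: DisertoriRivasseau2000, §IV.4 Lemma 10 (proof) p0016:L33–44] -/
theorem valid_lineEnds : Valid t T.codeN L.dotMap L.lineEnds := by
  refine ⟨fun c => ?_, ?_⟩
  · have hX := (L.orient_spec c).2
    obtain ⟨h0, h1⟩ := (Finset.mem_filter.1 hX).2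
    refine ⟨⟨?_, h0⟩, ⟨?_, h1⟩⟩
    · simp only [lineEnds, FieldTree.codeN_add_one]; exact (L.orient c).2
    · simp only [lineEnds, FieldTree.codeN_add_one]; exact (T.partner (L.orient c)).2
  · -- distinct slots: read the underlying fields
    let φ : ↥(crossAddrs t) × Bool → T.Field := fun p => if p.2 then T.partner (L.orient p.1) else L.orient p.1
    have hent : ∀ p, ent L.lineEnds p = ((φ p) : RawField n) := by
      rintro ⟨c, b⟩; cases b <;> rfl
    have hlm : ∀ p, L.lineMap (φ p) = p.1 := by
      rintro ⟨c, b⟩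
      cases b
      · exact L.lineMap_orient c
      · show L.lineMap (T.partner (L.orient c)) = c
        rw [L.lineMap_partner, L.lineMap_orient]
    intro p p' h
    rw [hent, hent] at h
    have hφ : φ p = φ p' := Subtype.ext h
    have hc : p.1 = p'.1 := by rw [← hlm p, ← hlm p', hφ]
    rcases p with ⟨c, b⟩
    rcases p' with ⟨c', b'⟩
    simp only at hc
    subst hc
    cases b <;> cases b'
    · rfl
    · exact absurd hφ.symm (T.partner_ne _)
    · exact absurd hφ (T.partner_ne _)
    · rfl

end Labelling

/-- The code `(𝒯,𝓛) ↦ ((V, 𝓛ₒ), (W, 𝓛ₓ))`. [cite: DisertoriRivasseau2000, §IV.4 Lemma 10 (proof) p0016:L17–33] -/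
def code (x : (T : FieldTree n) × Labelling t T) :
    ((Fin n → Fin 4) × (↥(dotAddrs t) → Fin n)) × (↥(crossAddrs t) → RawField n × RawField n) :=
  ((x.1.codeN, x.2.dotMap), x.2.lineEnds)

/-- The code determines the pair `(𝒯,𝓛)`. [cite: DisertoriRivasseau2000, §IV.4 Lemma 10 (proof) p0016:L17–33] -/
theorem code_injective : Function.Injective (code (n := n) (t := t)) := by
  rintro ⟨T, L⟩ ⟨T', L'⟩ h
  simp only [code, Prod.mk.injEq] at h
  obtain ⟨⟨hN, hD⟩, hE⟩ := h
  have hN' : T.N = T'.N := by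
    funext v
    have h1 := congrArg (fun g : Fin n → Fin 4 => ((g v : Fin 4) : ℕ) + 1) hN
    simp only [FieldTree.codeN_add_one] at h1
    exact h1
  have hE' : ∀ c, L.lineEnds c = L'.lineEnds c := fun c => congrFun hE c
  have hT : T = T' := by
    refine FieldTree.ext' hN' (fun f => ?_)
    have hc := hE' (L.lineMap f)
    simp only [Labelling.lineEnds, Prod.mk.injEq] at hc
    rcases L.eq_orient_or f with hf | hf
    · -- f is the first end of its line
      have h1 : (⟨f.1, by rw [← hN']; exact f.2⟩ : T'.Field) = L'.orient (L.lineMap f) :=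
        Subtype.ext (by rw [← hc.1, ← hf])
      rw [h1, ← hc.2, ← hf]
    · have h1 : (⟨f.1, by rw [← hN']; exact f.2⟩ : T'.Field) = T'.partner (L'.orient (L.lineMap f)) :=
        Subtype.ext (by rw [← hc.2, ← hf])
      rw [h1, T'.partner_partner, ← hc.1]
      conv_lhs => rw [hf, T.partner_partner]
  subst hT
  have hL : L = L' := by
    refine Labelling.ext' hD (funext fun f => ?_)
    have hc := hE' (L.lineMap f)
    simp only [Labelling.lineEnds, Prod.mk.injEq] at hc
    have ho : L'.orient (L.lineMap f) = L.orient (L.lineMap f) := Subtype.ext hc.1.symm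
    have h1 : L'.lineMap (L.orient (L.lineMap f)) = L.lineMap f := by rw [← ho, L'.lineMap_orient]
    rcases L.eq_orient_or f with hf | hf
    · conv_rhs => rw [hf]
      exact h1.symm
    · conv_rhs => rw [hf, L'.lineMap_partner]
      exact h1.symm
  subst hL
  rfl

/-- The number of injective dot labellings is `n!`. [cite: DisertoriRivasseau2000, §IV.4 Lemma 10 (proof) p0016:L47–48] -/
theorem card_injective_dotMaps (ht : t.dots = n) :
    (Finset.univ.filter (fun δ : ↥(dotAddrs t) → Fin n => Function.Injective δ)).card = n.factorial := by
  rw [← Fintype.card_subtype, Fintype.card_congr (Equiv.subtypeInjectiveEquivEmbedding _ _),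
    Fintype.card_embedding_eq, Fintype.card_coe, card_dotAddrs, ht, Fintype.card_fin, Nat.descFactorial_self]

/-- **Lemma 10 of [DR1] holds.** [cite: DisertoriRivasseau2000, §IV.4 Lemma 10 p0016:L12–52] -/
theorem Lemma10LabellingSum_holds : Lemma10LabellingSum := by
  intro n t ht F
  -- codes of the (V, 𝓛ₒ) part
  set key : ((T : FieldTree n) × Labelling t T) → (Fin n → Fin 4) × (↥(dotAddrs t) → Fin n) :=
    fun x => (code x).1 with hkey
  set K := F.image key with hK
  have hfib : ∀ k ∈ K, (∑ x ∈ F with key x = k,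
      (1 / (n.factorial : ℝ)) * ∏ a ∈ lineAddrs t, (1 / (x.2.extLines a : ℝ))) ≤ 1 / (n.factorial : ℝ) := by
    intro k hk
    obtain ⟨x₀, hx₀, hk₀⟩ := Finset.mem_image.1 hk
    -- on the fibre, N_ℓ = M k
    have hM : ∀ x ∈ F.filter (fun x => key x = k), ∀ a ∈ lineAddrs t, x.2.extLines a = M t k.1 k.2 a := by
      intro x hx a ha
      obtain ⟨-, hxk⟩ := Finset.mem_filter.1 hx
      subst hxk
      have h := x.2.extLines_add (Finset.mem_of_mem_erase ha)
      change x.2.extLines a + 2 * (crossesAbove t a).card = ∑ v ∈ vertsAbove t x.2.dotMap a, x.1.N v at h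
      show x.2.extLines a = (∑ v ∈ vertsAbove t x.2.dotMap a, ((x.1.codeN v : ℕ) + 1)) - 2 * (crossesAbove t a).card
      simp only [FieldTree.codeN_add_one]
      omega
    have hMpos : ∀ a ∈ lineAddrs t, 0 < M t k.1 k.2 a := by
      intro a ha
      rw [← hM x₀ (Finset.mem_filter.2 ⟨hx₀, hk₀⟩) a ha]
      exact x₀.2.extLines_pos ha
    -- the fibre injects into the valid assignments
    have hcard : (F.filter (fun x => key x = k)).card ≤ ∏ a ∈ lineAddrs t, M t k.1 k.2 a := by
      have hinj : k.2 = x₀.2.dotMap := by rw [← hk₀, hkey]; rfl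
      have hδ : Function.Injective k.2 := by rw [hinj]; exact x₀.2.dotMap_bijective.1
      refine le_trans ?_ (card_valid_le t k.1 k.2 hδ)
      refine Finset.card_le_card_of_injOn (fun x => (code x).2) ?_ ?_
      · intro x hx
        rw [Finset.coe_filter] at hx
        obtain ⟨-, hxk⟩ := hx
        subst hxk
        exact Finset.mem_coe.2 (Finset.mem_filter.2 ⟨Finset.mem_univ _, x.2.valid_lineEnds⟩)
      · intro x hx y hy hxy
        rw [Finset.coe_filter] at hx hy
        apply code_injective
        exact Prod.ext (hx.2.trans hy.2.symm) hxy
    -- sum over the fibre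
    set w : ℝ := (1 / (n.factorial : ℝ)) * ∏ a ∈ lineAddrs t, (1 / (M t k.1 k.2 a : ℝ)) with hw
    have hw_nonneg : 0 ≤ w := by
      rw [hw]
      refine mul_nonneg (by positivity) (Finset.prod_nonneg fun a _ => by positivity)
    calc (∑ x ∈ F with key x = k, (1 / (n.factorial : ℝ)) * ∏ a ∈ lineAddrs t, (1 / (x.2.extLines a : ℝ)))
        = ∑ x ∈ F with key x = k, w := by
          refine Finset.sum_congr rfl fun x hx => ?_
          rw [hw]
          congr 1
          exact Finset.prod_congr rfl fun a ha => by rw [hM x hx a ha]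
      _ = ((F.filter (fun x => key x = k)).card : ℝ) * w := by rw [Finset.sum_const, nsmul_eq_mul]
      _ ≤ ((∏ a ∈ lineAddrs t, M t k.1 k.2 a : ℕ) : ℝ) * w :=
          mul_le_mul_of_nonneg_right (by exact_mod_cast hcard) hw_nonneg
      _ = 1 / (n.factorial : ℝ) := by
          rw [hw, Nat.cast_prod, mul_left_comm, ← Finset.prod_mul_distrib, Finset.prod_eq_one, mul_one]
          intro a ha
          have : (M t k.1 k.2 a : ℝ) ≠ 0 := by exact_mod_cast (hMpos a ha).ne'
          exact mul_one_div_cancel this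
  -- the number of keys
  have hK_card : (K.card : ℝ) ≤ (4 : ℝ) ^ n * (n.factorial : ℝ) := by
    have hsub : K ⊆ (Finset.univ : Finset (Fin n → Fin 4)) ×ˢ
        (Finset.univ.filter (fun δ : ↥(dotAddrs t) → Fin n => Function.Injective δ)) := by
      intro k hk
      obtain ⟨x, -, rfl⟩ := Finset.mem_image.1 hk
      exact Finset.mem_product.2 ⟨Finset.mem_univ _, Finset.mem_filter.2 ⟨Finset.mem_univ _, x.2.dotMap_bijective.1⟩⟩
    have h := Finset.card_le_card hsub
    rw [Finset.card_product, Finset.card_univ, card_injective_dotMaps ht, Fintype.card_fun, Fintype.card_fin,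
      Fintype.card_fin] at h
    exact_mod_cast h
  have hfact : (0 : ℝ) < (n.factorial : ℝ) := by exact_mod_cast Nat.factorial_pos n
  calc (∑ x ∈ F, (1 / (n.factorial : ℝ)) * ∏ a ∈ lineAddrs t, (1 / (x.2.extLines a : ℝ)))
      = ∑ k ∈ K, ∑ x ∈ F with key x = k, (1 / (n.factorial : ℝ)) * ∏ a ∈ lineAddrs t, (1 / (x.2.extLines a : ℝ)) :=
        (Finset.sum_fiberwise_of_maps_to (fun x hx => Finset.mem_image_of_mem key hx) _).symm
    _ ≤ ∑ k ∈ K, 1 / (n.factorial : ℝ) := Finset.sum_le_sum hfib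
    _ = (K.card : ℝ) * (1 / (n.factorial : ℝ)) := by rw [Finset.sum_const, nsmul_eq_mul]
    _ ≤ ((4 : ℝ) ^ n * (n.factorial : ℝ)) * (1 / (n.factorial : ℝ)) :=
        mul_le_mul_of_nonneg_right hK_card (by positivity)
    _ = 4 ^ n := by field_simp

/-- The pairs `(𝒯,𝓛)` over a fixed CTS and vertex set form a finite type, so `Lemma10LabellingSum` is the bound on the
full sum. [cite: DisertoriRivasseau2000, §IV.4 Lemma 10 (proof) p0016:L17–33] -/
theorem finite_pairs (n : ℕ) (t : PlaneCTS) : Finite ((T : FieldTree n) × Labelling t T) :=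
  Finite.of_injective code code_injective

/-- The printed form of Lemma 10 on the full (finite) type of pairs `(𝒯,𝓛)`, for any enumeration of it.
[cite: DisertoriRivasseau2000, §IV.4 Lemma 10 p0016:L12–16] -/
theorem lemma10_sum_univ (n : ℕ) (t : PlaneCTS) (ht : t.dots = n) [Fintype ((T : FieldTree n) × Labelling t T)] :
    ∑ x : (T : FieldTree n) × Labelling t T,
      (1 / (n.factorial : ℝ)) * ∏ a ∈ lineAddrs t, (1 / (x.2.extLines a : ℝ)) ≤ 4 ^ n :=
  Lemma10LabellingSum_holds n t ht Finset.univ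

end LemmaTen

end Literature.MathematicalPhysics.QuantumLattice.FermiRG.DR2000
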